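import Summits.FinalStateConjecture.FinalStateConjecture.Theses.EIHFluxBalance
import Summits.FinalStateConjecture.FinalStateConjecture.Theorems.EIHFluxBalanceModulatedKerrHandoffTameDefs
import Summits.FinalStateConjecture.FinalStateConjecture.Theorems.EIHFluxBalanceInertialRecessionStubWeightedRatesReductionE0
import Literature.Geometry.Lorentzian.TameGenericityDiagonal
import Summits.FinalStateConjecture.FinalStateConjecture.Theorems.EIHFluxBalanceModulatedKerrHandoffStubSphericalMeansCalculusC2
import Summits.FinalStateConjecture.FinalStateConjecture.Theorems.EIHFluxBalanceModulatedKerrHandoffStubKirchhoffComparisonC2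
import Summits.FinalStateConjecture.FinalStateConjecture.Theorems.EIHFluxBalanceModulatedKerrHandoffStubRetardedConeEstimate
import Summits.FinalStateConjecture.FinalStateConjecture.Theorems.EIHFluxBalanceModulatedKerrHandoffStubWeightedConeDecayFinZero
import HarnessLib

/-!
# Line `cone-rates-are-iled` — skeleton for the crux `EIHFluxBalance.ModulatedKerrHandoff`
# (item stmt-FinalStateConjecture-17402, H′ = the TAME re-type, rev 6)

Planner `planner-cruxplan-stmt-FinalStateConjecture-17402-cone-rates-are-iled-0`, 2026-08-17.
Lead `prover-line-stmt-FinalStateConjecture-17402-a1-0` (2026-08-17): v2 reshape of S2; v3 (after wave 1) S2a/S2b/S2c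
LANDED (p143012, p143606, p144523+p145311) ⇒ S2 proved; S3 reshaped = N = 0 LANDED (p144141) ⊕ `stub_weightedConeDecayPos`.
Open sorries: S1 (`stub_trimmedConeCaptureGeneric`, conceded open core) and S3₊ (`stub_weightedConeDecayPos`, engine for N ≥ 1).
Card: `Cruxes/ModulatedKerrHandoff/Ideas/cone-rates-are-iled.md` (ideator 2, round 1; triage
r1-1/2/3: pass ×3, "mechanism for the weighted-deviation/(QS) block; engine printed for N ≤ 1").
Line card: `Lines/cone-rates-are-iled.md`; this file is published as `Lines/cone_rates_are_iled.lean` (module-name hygiene).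

## The cut (registered stubs after the v2/v3 reshapes; composition PROVED, sorry-free outside `stub_*`)

H′ is, by `Iff.rfl`, `∀ Σ, IsTameChristodoulouGeneric (admissibleVacuumData Σ) (HandoffPropT Σ) 1`
(`Theorems/…TameDefs.lean`). Its per-development clause `HandoffAnsatz` has exactly TWO clauses that
ask for RATES: (11) the `(1 + d^{7/4})`-weighted `C³` cone clause and (QS) weighted
quasi-stationarity of the painted background. This line cuts H′ ALONG THOSE TWO CLAUSES:

* `stub_trimmedConeCaptureGeneric` (S1, the conceded open core, in CONE-CAPTURE FORMAT): tame-
  generically the datum is trimmed (fast tails) and every MGHD has complete `𝓘⁺` and the handoff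
  ansatz WITHOUT (11)/(QS) but WITH three kinematic clauses of the painted moduli — (H) hyperbolic
  recession, (K) tame moduli, (WR) weighted 4-velocity rate `t^{3/4}‖(Λᵢe₀)˙‖ → 0` + bounded drift /
  axis rate (`ConeCaptureAnsatz`);
* S2, the card's first lemma `LieDragResponseDecay` (flat model) — RESHAPED by lead a1 (2026-08-17)
  into three registered stubs `stub_sphericalMeansCalculusC2` (S2a), `stub_kirchhoffComparisonC2`
  (S2b), `stub_retardedConeEstimate` (S2c) and PROVED from them (`lieDragResponseDecay_proof`);
  all three LANDED in wave 1 (Theorems/EIHFluxBalanceModulatedKerrHandoffStub{SphericalMeansCalculusC2,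
  KirchhoffComparisonC2,RetardedConeEstimate(+Helpers)}.lean) — S2 is a theorem of the tree;
* S3, THE ENGINE "cone rates are ILED" (XL, fed by S2): for trimmed admissible data, cone-capture ⇒
  (re-gauged) cone-capture WITH the weighted clause (11) (`WeightedConeCaptureAnsatz`) — v3: its N = 0
  instance LANDED (`stub_weightedConeDecayFinZero`, p144141), the N ≥ 1 engine is the registered
  `stub_weightedConeDecayPos`, and `weightedConeDecay_proof` derives the original S3 text by `cases N`;
* (QS) is then FREE: the landed e₀-reduction
  `SublinearIsFree.WeightedRates.weighted_fderiv_background_tendsto_zero_e0`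
  (Theorems/…StubWeightedRatesReductionE0.lean) derives (QS) from (WR) — kernel-checked here in
  `handoffAnsatz_of_weightedConeCaptureAnsatz`;
* `ModulatedKerrHandoff_of : ModulatedKerrHandoff` from the three `stub_*` (the crux BY NAME) by
  monotonicity of tame genericity (`IsTameChristodoulouGeneric.mono`, Literature); hypothesis form
  `handoffPropT_generic_of_stubs : CoreStmt → LieDragResponseDecay → EngineStmt → ∀ Σ, IsTameChristodoulouGeneric … (HandoffPropT Σ) 1`
  (sorry-free, axioms propext/Classical.choice/Quot.sound; `= ModulatedKerrHandoff` by `Iff.rfl`).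

Costume / shred self-audit: S1 is not the crux (it lacks (11)/(QS), which the landed
`WeightedQuasiStationarity/Negative/KinematicShadow` shows are NOT implied by the other clauses, and
it asserts trimming/(H)/(K)/(WR), which the crux does not); S3 is per-datum, deterministic, for
trimmed data only, and quantifier-conditional on capture — strictly weaker in kind than H′ (no
genericity, no censorship, no MGHD existence); S2 is a flat PDE lemma. No stub is a one-liner; the
difficulty is split two ways (large-data capture in S1; weighted late-time decay near modulated
multi-Kerr in S3 — the recorded blocker of overlap-modulation S4, "nothing of the kind in the tree").

Disproof used (tree `Disproof.lean` gen 3 / cycle 1, NO KILL, no `_false_without_` theorem for 17402):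
§4(a) constraints load-bearing — honoured (S1/S3 quantify over `admissibleVacuumData`); §4(c)
`IsMaximal` — S3 is asked of maximal developments only; §9 item 1 (hereditary `m = 0` tails) — S3 is
asked of TRIMMED data only (`o₄(r^{-15/8})`, above the `7/4` threshold), S1 puts trimming into the
generic property (composite trim ⊕ kick witnesses, BN-T1/T2); §9 item 10′ / BN1 (parabolic wall) —
(H) is a clause of S1's format, consumed by S3 exactly where the landed `stub_dragEstimates` consumes
it; §9 item 12 ((QS) ⟺ `t^{3/4}‖(Λe₀)˙‖ → 0` for one hole) — (WR) is that rate, and (QS) is derived,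
not posited; §6/§12 (`N = 0`: weight ≡ 1) — S3 is then the unweighted clause restricted to the cone.
Landed Negative lemmas `ModulatedKerrHandoff/Negative/{LoadBearing,Readback}` checked: no stub drops
constraints, `T2Space` or maximality.
-/

set_option linter.dupNamespace false
set_option linter.style.longLine false

noncomputable section

namespace Summit.FinalStateConjecture.FinalStateConjecture.Cruxes.ModulatedKerrHandoff.ConeRatesAreILED

open scoped BigOperators Topology Manifold ContDiff ENNReal
open Filter Set Function TopologicalSpace MeasureTheory Literature.Geometry.Lorentzian InitialDataSet
open Summit.FinalStateConjecture.FinalStateConjecture.Theses.EIHFluxBalance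
open Summit.FinalStateConjecture.FinalStateConjecture.Theorems.EIHFluxBalance.TameTemplate
open Summit.FinalStateConjecture.FinalStateConjecture.Theorems.SublinearIsFree.WeightedRates

/-! ## §1 Vocabulary (skeleton-local, Theses-free in content; the stubs below restate it INLINE) -/

section Vocabulary

variable (X : Type) [TopologicalSpace X] [ChartedSpace E3 X]
  [IsManifold (𝓡 3) ((⊤ : ℕ∞) : WithTop ℕ∞) X] [T2Space X] [SecondCountableTopology X]
  [ConnectedSpace X] (D : InitialDataSet (𝓡 3) X)

/-- **CONE-CAPTURE ANSATZ (the line's INPUT format, per development).** The handoff ansatz block of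
the crux (`TameTemplate.HandoffAnsatz`, Theorems/…TameDefs.lean) with its two WEIGHTED clauses —
(11) the `(1 + d^{7/4})`-weighted `C³` cone clause and (QS) weighted quasi-stationarity — DELETED,
and three KINEMATIC clauses of the painted moduli INSERTED after (4): (H) hyperbolic recession
`‖ξᵢ − ξⱼ‖ ≥ v t` eventually; (K) tame moduli after `τ₀` (`‖Λᵢ^{(k)}‖, ‖ξᵢ^{(k)}‖ ≤ A`, `k ≤ 4`)
— both verbatim the hypotheses of the landed `OverlapModulationSecondIterate.stub_dragEstimates`
(…DragEstimates.lean); (WR) the weighted 4-velocity rate `t^{3/4}‖(Λᵢe₀)˙‖ → 0`, bounded drift and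
bounded spin-axis rate — verbatim the hypotheses of the landed
`SublinearIsFree.WeightedRates.weighted_fderiv_background_tendsto_zero_e0`. Everything else —
sub-extremal labels and cores, Lorentz factors, smoothness, separation, cone, pinned domain, smooth
chart, open embedding, late image `⊆ O`, UNWEIGHTED whole-slab `C³` deviation `→ 0`, `O = exteriorOf`,
exhaustion, (T), (O), (R) — verbatim. [cite: DafermosLuk2017, Conjecture 1] -/
def ConeCaptureAnsatz (𝒟 : VacuumCauchyDevelopment D) : Prop :=
  ∃ (N : ℕ) (M a rin : Fin N → ℝ) (Λ : Fin N → ℝ → lorentzGroup) (ξ : Fin N → ℝ → E3) (γ κ τ₀ A : ℝ) (U : Opens E4) (Φ : U → 𝒟.carrier) (O : Set 𝒟.carrier), (∀ i, Kerr.IsSubextremal (M i) (a i) ∧ Kerr.rMinus (M i) (a i) < rin i ∧ rin i < Kerr.rPlus (M i) (a i)) ∧ (∀ i t, |((Λ i t : E4 ≃L[ℝ] E4) (E4.basisVector 0)) 0| ≤ γ) ∧ (∀ i, ContDiff ℝ ((⊤ : ℕ∞) : WithTop ℕ∞) (ξ i) ∧ ContDiff ℝ ((⊤ : ℕ∞)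 : WithTop ℕ∞) (fun t ↦ ((Λ i t : E4 ≃L[ℝ] E4) : E4 →L[ℝ] E4))) ∧ (∀ i j, i ≠ j → Tendsto (fun t ↦ ‖ξ i t - ξ j t‖) atTop atTop) ∧ (∀ i j, i ≠ j → ∃ v : ℝ, 0 < v ∧ ∀ᶠ t in atTop, v * t ≤ ‖ξ i t - ξ j t‖) ∧ (∀ i t, τ₀ ≤ t → (∀ k, k ≤ 4 → ‖iteratedDeriv k (fun s ↦ ((Λ i s : E4 ≃L[ℝ] E4) : E4 →L[ℝ] E4)) t‖ ≤ A) ∧ ∀ k, 1 ≤ k → k ≤ 4 → ‖iteratedDeriv k (ξ i) t‖ ≤ A) ∧ (∀ i, Tendsto (fun t : ℝ ↦ t ^ (3 / 4 : ℝ) * ‖deriv (fun s ↦ (((Λ i s : lorentzGroup) : E4 ≃L[ℝ] E4) (E4.basisVector 0))) t‖) atTop (𝓝 0) ∧ (∃ V : ℝ, ∀ᶠ t in atTop, ‖deriv (ξ i) t‖ ≤ V) ∧ (∃ V₃ : ℝ, a i ≠ 0 → ∀ᶠ t in atTop, ‖deriv (fun s ↦ (((Λ i s : lorentzGroup) : E4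 ≃L[ℝ] E4) (E4.basisVector 3))) t‖ ≤ V₃)) ∧ (0 < κ ∧ κ < 1 ∧ ∀ i, ∀ᶠ t in atTop, ‖ξ i t‖ ≤ κ ^ 2 * t) ∧ ({x : E4 | τ₀ < x 0 ∧ ∀ i, rin i < Kerr.radius (a i) (poincareInv (Λ i (x 0)) (E4.ofTimeSpace (x 0) (ξ i (x 0))) x)} ⊆ (U : Set E4)) ∧ let B : ModelBackground := ⟨U, fun x ↦ Minkowski.bilin + ∑ i, (boostedKerrBilin (Λ i (x 0)) (E4.ofTimeSpace (x 0) (ξ i (x 0))) (M i) (a i) x - Minkowski.bilin), fun x ↦ x 0, E4.spatialNorm⟩; ContMDiff 𝓘(ℝ, E4) (𝓡 4) ((⊤ : ℕ∞) : WithTop ℕ∞) Φ ∧ Topology.IsOpenEmbedding ((B.lateRegion τ₀).restrict Φ) ∧ Φ '' {x : U | τ₀ < x.1 0 ∧ ∀ i, Kerr.rPlus (M i) (a i) < Kerr.radius (a i) (poincareInv (Λ i (x.1 0)) (E4.ofTimeSpace (x.1 0) (ξ i (x.1 0))) x.1)} ⊆ O ∧ Tendsto (fun t ↦ 𝒟.toSpacetime.deviationCk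 B Φ 3 t) atTop (𝓝 0) ∧ O = Summit.FinalStateConjecture.exteriorOf 𝒟.toCauchyDevelopment (Φ '' {x : U | τ₀ < x.1 0 ∧ ∀ i, Kerr.rPlus (M i) (a i) < Kerr.radius (a i) (poincareInv (Λ i (x.1 0)) (E4.ofTimeSpace (x.1 0) (ξ i (x.1 0))) x.1)}) ∧ (∀ t₁ : ℝ, τ₀ < t₁ → O \ Φ '' {x : U | t₁ < x.1 0 ∧ ∀ i, Kerr.rPlus (M i) (a i) < Kerr.radius (a i) (poincareInv (Λ i (x.1 0)) (E4.ofTimeSpace (x.1 0) (ξ i (x.1 0))) x.1)} ⊆ 𝒟.metric.causalPast 𝒟.timeOrientation (Φ '' {x : U | x.1 0 = t₁ ∧ ∀ i, Kerr.rPlus (M i) (a i) < Kerr.radius (a i) (poincareInv (Λ i (x.1 0)) (E4.ofTimeSpace (x.1 0) (ξ i (x.1 0))) x.1)})) ∧ (∃ τ₁ : ℝ, ∀ x y : U, (τ₁ < x.1 0 ∧ ∀ i, rin i < Kerr.radius (a i) (poincareInv (Λ i (x.1 0)) (E4.ofTimeSpace (x.1 0) (ξ i (x.1 0))) x.1)) →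 (τ₁ < y.1 0 ∧ ∀ i, rin i < Kerr.radius (a i) (poincareInv (Λ i (y.1 0)) (E4.ofTimeSpace (y.1 0) (ξ i (y.1 0))) y.1)) → Φ y ∈ 𝒟.metric.causalFuture 𝒟.timeOrientation {Φ x} → x.1 0 ≤ y.1 0) ∧ (∀ (i : Fin N) (t : ℝ), 0 < (((Λ i t : lorentzGroup) : E4 ≃L[ℝ] E4) (E4.basisVector 0)) 0) ∧ Summit.FinalStateConjecture.RaysStayInClosure 𝒟.toCauchyDevelopment O

/-- **WEIGHTED CONE-CAPTURE ANSATZ (the engine's OUTPUT format).** `ConeCaptureAnsatz` with the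
crux's weighted cone clause (11) re-inserted at its place (between the unweighted clause and
`O = exteriorOf`); (QS) is still absent — it is DERIVED below from (WR) by the landed e₀-reduction.
[cite: DafermosLuk2017, Conjecture 1] -/
def WeightedConeCaptureAnsatz (𝒟 : VacuumCauchyDevelopment D) : Prop :=
  ∃ (N : ℕ) (M a rin : Fin N → ℝ) (Λ : Fin N → ℝ → lorentzGroup) (ξ : Fin N → ℝ → E3) (γ κ τ₀ A : ℝ) (U : Opens E4) (Φ : U → 𝒟.carrier) (O : Set 𝒟.carrier), (∀ i, Kerr.IsSubextremal (M i) (a i) ∧ Kerr.rMinus (M i) (a i) < rin i ∧ rin i < Kerr.rPlus (M i) (a i)) ∧ (∀ i t, |((Λ i t : E4 ≃L[ℝ] E4) (E4.basisVector 0)) 0| ≤ γ) ∧ (∀ i, ContDiff ℝ ((⊤ : ℕ∞) : WithTop ℕ∞) (ξ i) ∧ ContDiff ℝ ((⊤ : ℕ∞) : WithTop ℕ∞) (fun t ↦ ((Λ i t : E4 ≃L[ℝ] E4) : E4 →L[ℝ] E4))) ∧ (∀ i j, i ≠ j → Tendsto (fun t ↦ ‖ξ i t - ξ j t‖) atTop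 atTop) ∧ (∀ i j, i ≠ j → ∃ v : ℝ, 0 < v ∧ ∀ᶠ t in atTop, v * t ≤ ‖ξ i t - ξ j t‖) ∧ (∀ i t, τ₀ ≤ t → (∀ k, k ≤ 4 → ‖iteratedDeriv k (fun s ↦ ((Λ i s : E4 ≃L[ℝ] E4) : E4 →L[ℝ] E4)) t‖ ≤ A) ∧ ∀ k, 1 ≤ k → k ≤ 4 → ‖iteratedDeriv k (ξ i) t‖ ≤ A) ∧ (∀ i, Tendsto (fun t : ℝ ↦ t ^ (3 / 4 : ℝ) * ‖deriv (fun s ↦ (((Λ i s : lorentzGroup) : E4 ≃L[ℝ] E4) (E4.basisVector 0))) t‖) atTop (𝓝 0) ∧ (∃ V : ℝ, ∀ᶠ t in atTop, ‖deriv (ξ i) t‖ ≤ V) ∧ (∃ V₃ : ℝ, a i ≠ 0 → ∀ᶠ t in atTop, ‖deriv (fun s ↦ (((Λ i s : lorentzGroup) : E4 ≃L[ℝ] E4) (E4.basisVector 3))) t‖ ≤ V₃)) ∧ (0 < κ ∧ κ < 1 ∧ ∀ i, ∀ᶠ t in atTop, ‖ξ i t‖ ≤ κ ^ 2 * t) ∧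 ({x : E4 | τ₀ < x 0 ∧ ∀ i, rin i < Kerr.radius (a i) (poincareInv (Λ i (x 0)) (E4.ofTimeSpace (x 0) (ξ i (x 0))) x)} ⊆ (U : Set E4)) ∧ let B : ModelBackground := ⟨U, fun x ↦ Minkowski.bilin + ∑ i, (boostedKerrBilin (Λ i (x 0)) (E4.ofTimeSpace (x 0) (ξ i (x 0))) (M i) (a i) x - Minkowski.bilin), fun x ↦ x 0, E4.spatialNorm⟩; ContMDiff 𝓘(ℝ, E4) (𝓡 4) ((⊤ : ℕ∞) : WithTop ℕ∞) Φ ∧ Topology.IsOpenEmbedding ((B.lateRegion τ₀).restrict Φ) ∧ Φ '' {x : U | τ₀ < x.1 0 ∧ ∀ i, Kerr.rPlus (M i) (a i) < Kerr.radius (a i) (poincareInv (Λ i (x.1 0)) (E4.ofTimeSpace (x.1 0) (ξ i (x.1 0))) x.1)} ⊆ O ∧ Tendsto (fun t ↦ 𝒟.toSpacetime.deviationCk B Φ 3 t) atTop (𝓝 0) ∧ Tendsto (fun t : ℝ ↦ ⨆ x ∈ {x : U | x.1 0 = t ∧ E4.spatialNorm x.1 ≤ κ * t}, ⨆ (m :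 ℕ) (_ : m ≤ 3), ENNReal.ofReal (1 + √(√((⨅ i, ‖E4.spatial x.1 - ξ i t‖) ^ 7))) * ‖iteratedFDeriv ℝ m (𝒟.toSpacetime.deviationExtend B Φ) x.1‖ₑ) atTop (𝓝 0) ∧ O = Summit.FinalStateConjecture.exteriorOf 𝒟.toCauchyDevelopment (Φ '' {x : U | τ₀ < x.1 0 ∧ ∀ i, Kerr.rPlus (M i) (a i) < Kerr.radius (a i) (poincareInv (Λ i (x.1 0)) (E4.ofTimeSpace (x.1 0) (ξ i (x.1 0))) x.1)}) ∧ (∀ t₁ : ℝ, τ₀ < t₁ → O \ Φ '' {x : U | t₁ < x.1 0 ∧ ∀ i, Kerr.rPlus (M i) (a i) < Kerr.radius (a i) (poincareInv (Λ i (x.1 0)) (E4.ofTimeSpace (x.1 0) (ξ i (x.1 0))) x.1)} ⊆ 𝒟.metric.causalPast 𝒟.timeOrientation (Φ '' {x : U | x.1 0 = t₁ ∧ ∀ i, Kerr.rPlus (M i) (a i) < Kerr.radius (a i) (poincareInv (Λ i (x.1 0)) (E4.ofTimeSpace (x.1 0) (ξ i (x.1 0))) x.1)})) ∧ (∃ τ₁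 : ℝ, ∀ x y : U, (τ₁ < x.1 0 ∧ ∀ i, rin i < Kerr.radius (a i) (poincareInv (Λ i (x.1 0)) (E4.ofTimeSpace (x.1 0) (ξ i (x.1 0))) x.1)) → (τ₁ < y.1 0 ∧ ∀ i, rin i < Kerr.radius (a i) (poincareInv (Λ i (y.1 0)) (E4.ofTimeSpace (y.1 0) (ξ i (y.1 0))) y.1)) → Φ y ∈ 𝒟.metric.causalFuture 𝒟.timeOrientation {Φ x} → x.1 0 ≤ y.1 0) ∧ (∀ (i : Fin N) (t : ℝ), 0 < (((Λ i t : lorentzGroup) : E4 ≃L[ℝ] E4) (E4.basisVector 0)) 0) ∧ Summit.FinalStateConjecture.RaysStayInClosure 𝒟.toCauchyDevelopment O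

/-- **Trimmed (fast-tail) datum**: on a sole end, `h − (1 + 2M/r)δ = o₄(r^{-15/8})`, `k = o₃(r^{-23/8})`
— the numbers of line `trim-kick-censorship`'s `IsTrimmed` (its stub K's members are trimmed in
exactly this sense), above the hereditary-tail threshold `7/4` of Disproof §9 item 1.
[cite: CorvinoSchoen2006, Thm 1] -/
def IsTrimmedDatum : Prop :=
  (∃ (e : AFEnd X) (Mₑ : ℝ), e.IsSoleEnd ∧ e.IsStronglyAsymptoticallyFlatWith D Mₑ (15 / 8) (23 / 8) 4 3)

/-- **The per-datum property of the core stub**: trimmed, an MGHD exists, and every MGHD has complete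
`𝓘⁺` and the cone-capture ansatz. [cite: DafermosLuk2017, Conjecture 1] -/
def ConeCapturePropT : Prop :=
  (∃ (e : AFEnd X) (Mₑ : ℝ), e.IsSoleEnd ∧ e.IsStronglyAsymptoticallyFlatWith D Mₑ (15 / 8) (23 / 8) 4 3) ∧ (∃ 𝒟 : VacuumCauchyDevelopment D, 𝒟.IsMaximal) ∧ ∀ 𝒟 : VacuumCauchyDevelopment D, 𝒟.IsMaximal → Summit.FinalStateConjecture.HasCompleteNullInfinity 𝒟.toCauchyDevelopment ∧ (∃ (N : ℕ) (M a rin : Fin N → ℝ) (Λ : Fin N → ℝ → lorentzGroup) (ξ : Fin N → ℝ → E3) (γ κ τ₀ A : ℝ) (U : Opens E4) (Φ : U → 𝒟.carrier) (O : Set 𝒟.carrier), (∀ i, Kerr.IsSubextremal (M i) (a i) ∧ Kerr.rMinus (M i) (a i) < rin i ∧ rin i < Kerr.rPlus (M i) (a i)) ∧ (∀ i t, |((Λ i t : E4 ≃L[ℝ] E4) (E4.basisVector 0)) 0| ≤ γ) ∧ (∀ i, ContDiff ℝ ((⊤ : ℕ∞) : WithTop ℕ∞) (ξ i) ∧ ContDiff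 ℝ ((⊤ : ℕ∞) : WithTop ℕ∞) (fun t ↦ ((Λ i t : E4 ≃L[ℝ] E4) : E4 →L[ℝ] E4))) ∧ (∀ i j, i ≠ j → Tendsto (fun t ↦ ‖ξ i t - ξ j t‖) atTop atTop) ∧ (∀ i j, i ≠ j → ∃ v : ℝ, 0 < v ∧ ∀ᶠ t in atTop, v * t ≤ ‖ξ i t - ξ j t‖) ∧ (∀ i t, τ₀ ≤ t → (∀ k, k ≤ 4 → ‖iteratedDeriv k (fun s ↦ ((Λ i s : E4 ≃L[ℝ] E4) : E4 →L[ℝ] E4)) t‖ ≤ A) ∧ ∀ k, 1 ≤ k → k ≤ 4 → ‖iteratedDeriv k (ξ i) t‖ ≤ A) ∧ (∀ i, Tendsto (fun t : ℝ ↦ t ^ (3 / 4 : ℝ) * ‖deriv (fun s ↦ (((Λ i s : lorentzGroup) : E4 ≃L[ℝ] E4) (E4.basisVector 0))) t‖) atTop (𝓝 0) ∧ (∃ V : ℝ, ∀ᶠ t in atTop, ‖deriv (ξ i) t‖ ≤ V) ∧ (∃ V₃ : ℝ, a i ≠ 0 → ∀ᶠ t in atTop, ‖deriv (fun s ↦ (((Λ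 i s : lorentzGroup) : E4 ≃L[ℝ] E4) (E4.basisVector 3))) t‖ ≤ V₃)) ∧ (0 < κ ∧ κ < 1 ∧ ∀ i, ∀ᶠ t in atTop, ‖ξ i t‖ ≤ κ ^ 2 * t) ∧ ({x : E4 | τ₀ < x 0 ∧ ∀ i, rin i < Kerr.radius (a i) (poincareInv (Λ i (x 0)) (E4.ofTimeSpace (x 0) (ξ i (x 0))) x)} ⊆ (U : Set E4)) ∧ let B : ModelBackground := ⟨U, fun x ↦ Minkowski.bilin + ∑ i, (boostedKerrBilin (Λ i (x 0)) (E4.ofTimeSpace (x 0) (ξ i (x 0))) (M i) (a i) x - Minkowski.bilin), fun x ↦ x 0, E4.spatialNorm⟩; ContMDiff 𝓘(ℝ, E4) (𝓡 4) ((⊤ : ℕ∞) : WithTop ℕ∞) Φ ∧ Topology.IsOpenEmbedding ((B.lateRegion τ₀).restrict Φ) ∧ Φ '' {x : U | τ₀ < x.1 0 ∧ ∀ i, Kerr.rPlus (M i) (a i) < Kerr.radius (a i) (poincareInv (Λ i (x.1 0)) (E4.ofTimeSpace (x.1 0) (ξ i (x.1 0))) x.1)} ⊆ O ∧ Tendsto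 (fun t ↦ 𝒟.toSpacetime.deviationCk B Φ 3 t) atTop (𝓝 0) ∧ O = Summit.FinalStateConjecture.exteriorOf 𝒟.toCauchyDevelopment (Φ '' {x : U | τ₀ < x.1 0 ∧ ∀ i, Kerr.rPlus (M i) (a i) < Kerr.radius (a i) (poincareInv (Λ i (x.1 0)) (E4.ofTimeSpace (x.1 0) (ξ i (x.1 0))) x.1)}) ∧ (∀ t₁ : ℝ, τ₀ < t₁ → O \ Φ '' {x : U | t₁ < x.1 0 ∧ ∀ i, Kerr.rPlus (M i) (a i) < Kerr.radius (a i) (poincareInv (Λ i (x.1 0)) (E4.ofTimeSpace (x.1 0) (ξ i (x.1 0))) x.1)} ⊆ 𝒟.metric.causalPast 𝒟.timeOrientation (Φ '' {x : U | x.1 0 = t₁ ∧ ∀ i, Kerr.rPlus (M i) (a i) < Kerr.radius (a i) (poincareInv (Λ i (x.1 0)) (E4.ofTimeSpace (x.1 0) (ξ i (x.1 0))) x.1)})) ∧ (∃ τ₁ : ℝ, ∀ x y : U, (τ₁ < x.1 0 ∧ ∀ i, rin i < Kerr.radius (a i) (poincareInv (Λ i (x.1 0)) (E4.ofTimeSpace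 (x.1 0) (ξ i (x.1 0))) x.1)) → (τ₁ < y.1 0 ∧ ∀ i, rin i < Kerr.radius (a i) (poincareInv (Λ i (y.1 0)) (E4.ofTimeSpace (y.1 0) (ξ i (y.1 0))) y.1)) → Φ y ∈ 𝒟.metric.causalFuture 𝒟.timeOrientation {Φ x} → x.1 0 ≤ y.1 0) ∧ (∀ (i : Fin N) (t : ℝ), 0 < (((Λ i t : lorentzGroup) : E4 ≃L[ℝ] E4) (E4.basisVector 0)) 0) ∧ Summit.FinalStateConjecture.RaysStayInClosure 𝒟.toCauchyDevelopment O)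

end Vocabulary

/-- **The card's first lemma, def-free** (`Ideas/cone-rates-are-iled.md`, ideator's `Sketch.lean` rc 0;
`e₁` inlined as `EuclideanSpace.single 0 1`): the flat forced response to the Lie-drag-corrected
two-centre defect profile `A t⁻²Σ±(M + ‖x ∓ ½vt e₁‖)⁻²`, supported in the lab cone, with zero Cauchy
data at `t = 1`, is `O(A log(1+t)/t²)` in the cone `‖x‖ ≤ κt`. [folklore] -/
def LieDragResponseDecay : Prop :=
  ∀ (A M v κ : ℝ), 0 ≤ A → 0 < M → 0 < v → v < κ → κ < 1 → ∃ C : ℝ, ∀ (u f : ℝ → E3 → ℝ), ContDiff ℝ 2 (fun p : ℝ × E3 ↦ u p.1 p.2) → Continuous (fun p : ℝ × E3 ↦ f p.1 p.2) → (∀ x, u 1 x = 0 ∧ deriv (fun s ↦ u s x) 1 = 0) → (∀ t x, 1 ≤ t → deriv (fun s ↦ deriv (fun s' ↦ u s' x) s) t = ∑ i : Fin 3, deriv (fun s : ℝ ↦ deriv (fun s' : ℝ ↦ u t (x + s' • EuclideanSpace.single i (1 : ℝ))) s) (0 : ℝ) + f t x) → (∀ t x, 1 ≤ t → κ * t < ‖x‖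 → f t x = 0) → (∀ t x, 1 ≤ t → |f t x| ≤ A * t⁻¹ ^ 2 * ((M + ‖x - (v * t / 2) • EuclideanSpace.single (0 : Fin 3) (1 : ℝ)‖)⁻¹ ^ 2 + (M + ‖x + (v * t / 2) • EuclideanSpace.single (0 : Fin 3) (1 : ℝ)‖)⁻¹ ^ 2)) → ∀ t x, 1 ≤ t → ‖x‖ ≤ κ * t → |u t x| ≤ C * A * Real.log (1 + t) / t ^ 2

/-- Statement of the core stub as a `Prop` (for the hypothesis-form composition). [cite: DafermosLuk2017, Conjecture 1] -/
def CoreStmt : Prop :=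
  ∀ (X : Type) [TopologicalSpace X] [ChartedSpace E3 X] [IsManifold (𝓡 3) ((⊤ : ℕ∞) : WithTop ℕ∞) X] [T2Space X] [SecondCountableTopology X] [ConnectedSpace X], InitialDataSet.IsTameChristodoulouGeneric (admissibleVacuumData X) (fun D ↦ (∃ (e : AFEnd X) (Mₑ : ℝ), e.IsSoleEnd ∧ e.IsStronglyAsymptoticallyFlatWith D Mₑ (15 / 8) (23 / 8) 4 3) ∧ (∃ 𝒟 : VacuumCauchyDevelopment D, 𝒟.IsMaximal) ∧ ∀ 𝒟 : VacuumCauchyDevelopment D, 𝒟.IsMaximal → Summit.FinalStateConjecture.HasCompleteNullInfinity 𝒟.toCauchyDevelopment ∧ (∃ (N : ℕ) (M a rin : Fin N → ℝ) (Λ : Fin N → ℝ → lorentzGroup) (ξ : Fin N → ℝ → E3) (γ κ τ₀ A : ℝ) (U : Opens E4) (Φ : U → 𝒟.carrier) (O : Set 𝒟.carrier), (∀ i, Kerr.IsSubextremal (M i) (a i) ∧ Kerr.rMinus (M i) (a i) < rin i ∧ rin i < Kerr.rPlus (M i) (a i)) ∧ (∀ i t, |((Λ i t : E4 ≃L[ℝ]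 E4) (E4.basisVector 0)) 0| ≤ γ) ∧ (∀ i, ContDiff ℝ ((⊤ : ℕ∞) : WithTop ℕ∞) (ξ i) ∧ ContDiff ℝ ((⊤ : ℕ∞) : WithTop ℕ∞) (fun t ↦ ((Λ i t : E4 ≃L[ℝ] E4) : E4 →L[ℝ] E4))) ∧ (∀ i j, i ≠ j → Tendsto (fun t ↦ ‖ξ i t - ξ j t‖) atTop atTop) ∧ (∀ i j, i ≠ j → ∃ v : ℝ, 0 < v ∧ ∀ᶠ t in atTop, v * t ≤ ‖ξ i t - ξ j t‖) ∧ (∀ i t, τ₀ ≤ t → (∀ k, k ≤ 4 → ‖iteratedDeriv k (fun s ↦ ((Λ i s : E4 ≃L[ℝ] E4) : E4 →L[ℝ] E4)) t‖ ≤ A) ∧ ∀ k, 1 ≤ k → k ≤ 4 → ‖iteratedDeriv k (ξ i) t‖ ≤ A) ∧ (∀ i, Tendsto (fun t : ℝ ↦ t ^ (3 / 4 : ℝ) * ‖deriv (fun s ↦ (((Λ i s : lorentzGroup) : E4 ≃L[ℝ] E4) (E4.basisVector 0))) t‖) atTop (𝓝 0) ∧ (∃ V : ℝ, ∀ᶠ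 t in atTop, ‖deriv (ξ i) t‖ ≤ V) ∧ (∃ V₃ : ℝ, a i ≠ 0 → ∀ᶠ t in atTop, ‖deriv (fun s ↦ (((Λ i s : lorentzGroup) : E4 ≃L[ℝ] E4) (E4.basisVector 3))) t‖ ≤ V₃)) ∧ (0 < κ ∧ κ < 1 ∧ ∀ i, ∀ᶠ t in atTop, ‖ξ i t‖ ≤ κ ^ 2 * t) ∧ ({x : E4 | τ₀ < x 0 ∧ ∀ i, rin i < Kerr.radius (a i) (poincareInv (Λ i (x 0)) (E4.ofTimeSpace (x 0) (ξ i (x 0))) x)} ⊆ (U : Set E4)) ∧ let B : ModelBackground := ⟨U, fun x ↦ Minkowski.bilin + ∑ i, (boostedKerrBilin (Λ i (x 0)) (E4.ofTimeSpace (x 0) (ξ i (x 0))) (M i) (a i) x - Minkowski.bilin), fun x ↦ x 0, E4.spatialNorm⟩; ContMDiff 𝓘(ℝ, E4) (𝓡 4) ((⊤ : ℕ∞) : WithTop ℕ∞) Φ ∧ Topology.IsOpenEmbedding ((B.lateRegion τ₀).restrict Φ) ∧ Φ '' {x : U | τ₀ < x.1 0 ∧ ∀ i, Kerr.rPlus (M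 i) (a i) < Kerr.radius (a i) (poincareInv (Λ i (x.1 0)) (E4.ofTimeSpace (x.1 0) (ξ i (x.1 0))) x.1)} ⊆ O ∧ Tendsto (fun t ↦ 𝒟.toSpacetime.deviationCk B Φ 3 t) atTop (𝓝 0) ∧ O = Summit.FinalStateConjecture.exteriorOf 𝒟.toCauchyDevelopment (Φ '' {x : U | τ₀ < x.1 0 ∧ ∀ i, Kerr.rPlus (M i) (a i) < Kerr.radius (a i) (poincareInv (Λ i (x.1 0)) (E4.ofTimeSpace (x.1 0) (ξ i (x.1 0))) x.1)}) ∧ (∀ t₁ : ℝ, τ₀ < t₁ → O \ Φ '' {x : U | t₁ < x.1 0 ∧ ∀ i, Kerr.rPlus (M i) (a i) < Kerr.radius (a i) (poincareInv (Λ i (x.1 0)) (E4.ofTimeSpace (x.1 0) (ξ i (x.1 0))) x.1)} ⊆ 𝒟.metric.causalPast 𝒟.timeOrientation (Φ '' {x : U | x.1 0 = t₁ ∧ ∀ i, Kerr.rPlus (M i) (a i) < Kerr.radius (a i) (poincareInv (Λ i (x.1 0)) (E4.ofTimeSpace (x.1 0) (ξ i (x.1 0))) x.1)})) ∧ (∃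 τ₁ : ℝ, ∀ x y : U, (τ₁ < x.1 0 ∧ ∀ i, rin i < Kerr.radius (a i) (poincareInv (Λ i (x.1 0)) (E4.ofTimeSpace (x.1 0) (ξ i (x.1 0))) x.1)) → (τ₁ < y.1 0 ∧ ∀ i, rin i < Kerr.radius (a i) (poincareInv (Λ i (y.1 0)) (E4.ofTimeSpace (y.1 0) (ξ i (y.1 0))) y.1)) → Φ y ∈ 𝒟.metric.causalFuture 𝒟.timeOrientation {Φ x} → x.1 0 ≤ y.1 0) ∧ (∀ (i : Fin N) (t : ℝ), 0 < (((Λ i t : lorentzGroup) : E4 ≃L[ℝ] E4) (E4.basisVector 0)) 0) ∧ Summit.FinalStateConjecture.RaysStayInClosure 𝒟.toCauchyDevelopment O)) 1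

/-- Statement of the engine stub as a `Prop` (for the hypothesis-form composition). [cite: MetcalfeTataruTohaneanu2012, Thm 5] -/
def EngineStmt : Prop :=
  (∀ (A M v κ : ℝ), 0 ≤ A → 0 < M → 0 < v → v < κ → κ < 1 → ∃ C : ℝ, ∀ (u f : ℝ → E3 → ℝ), ContDiff ℝ 2 (fun p : ℝ × E3 ↦ u p.1 p.2) → Continuous (fun p : ℝ × E3 ↦ f p.1 p.2) → (∀ x, u 1 x = 0 ∧ deriv (fun s ↦ u s x) 1 = 0) → (∀ t x, 1 ≤ t → deriv (fun s ↦ deriv (fun s' ↦ u s' x) s) t = ∑ i : Fin 3, deriv (fun s : ℝ ↦ deriv (fun s' : ℝ ↦ u t (x + s' • EuclideanSpace.single i (1 : ℝ))) s) (0 : ℝ) + f t x) → (∀ t x, 1 ≤ t → κ * t < ‖x‖ → f t x = 0) → (∀ t x, 1 ≤ t → |f t x| ≤ A * t⁻¹ ^ 2 * ((M + ‖x - (v * t / 2) • EuclideanSpace.single (0 : Fin 3) (1 : ℝ)‖)⁻¹ ^ 2 + (M + ‖x + (v * t / 2) • EuclideanSpace.single (0 : Fin 3) (1 : ℝ)‖)⁻¹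 ^ 2)) → ∀ t x, 1 ≤ t → ‖x‖ ≤ κ * t → |u t x| ≤ C * A * Real.log (1 + t) / t ^ 2) → ∀ (X : Type) [TopologicalSpace X] [ChartedSpace E3 X] [IsManifold (𝓡 3) ((⊤ : ℕ∞) : WithTop ℕ∞) X] [T2Space X] [SecondCountableTopology X] [ConnectedSpace X], ∀ D ∈ admissibleVacuumData X, (∃ (e : AFEnd X) (Mₑ : ℝ), e.IsSoleEnd ∧ e.IsStronglyAsymptoticallyFlatWith D Mₑ (15 / 8) (23 / 8) 4 3) → ∀ 𝒟 : VacuumCauchyDevelopment D, 𝒟.IsMaximal → (∃ (N : ℕ) (M a rin : Fin N → ℝ) (Λ : Fin N → ℝ → lorentzGroup) (ξ : Fin N → ℝ → E3) (γ κ τ₀ A : ℝ) (U : Opens E4) (Φ : U → 𝒟.carrier) (O : Set 𝒟.carrier), (∀ i, Kerr.IsSubextremal (M i) (a i) ∧ Kerr.rMinus (M i) (a i) < rin i ∧ rin i < Kerr.rPlus (M i) (a i)) ∧ (∀ i t, |((Λ i t : E4 ≃L[ℝ] E4) (E4.basisVector 0)) 0| ≤ γ) ∧ (∀ i, ContDiff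 ℝ ((⊤ : ℕ∞) : WithTop ℕ∞) (ξ i) ∧ ContDiff ℝ ((⊤ : ℕ∞) : WithTop ℕ∞) (fun t ↦ ((Λ i t : E4 ≃L[ℝ] E4) : E4 →L[ℝ] E4))) ∧ (∀ i j, i ≠ j → Tendsto (fun t ↦ ‖ξ i t - ξ j t‖) atTop atTop) ∧ (∀ i j, i ≠ j → ∃ v : ℝ, 0 < v ∧ ∀ᶠ t in atTop, v * t ≤ ‖ξ i t - ξ j t‖) ∧ (∀ i t, τ₀ ≤ t → (∀ k, k ≤ 4 → ‖iteratedDeriv k (fun s ↦ ((Λ i s : E4 ≃L[ℝ] E4) : E4 →L[ℝ] E4)) t‖ ≤ A) ∧ ∀ k, 1 ≤ k → k ≤ 4 → ‖iteratedDeriv k (ξ i) t‖ ≤ A) ∧ (∀ i, Tendsto (fun t : ℝ ↦ t ^ (3 / 4 : ℝ) * ‖deriv (fun s ↦ (((Λ i s : lorentzGroup) : E4 ≃L[ℝ] E4) (E4.basisVector 0))) t‖) atTop (𝓝 0) ∧ (∃ V : ℝ, ∀ᶠ t in atTop, ‖deriv (ξ i) t‖ ≤ V) ∧ (∃ V₃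 : ℝ, a i ≠ 0 → ∀ᶠ t in atTop, ‖deriv (fun s ↦ (((Λ i s : lorentzGroup) : E4 ≃L[ℝ] E4) (E4.basisVector 3))) t‖ ≤ V₃)) ∧ (0 < κ ∧ κ < 1 ∧ ∀ i, ∀ᶠ t in atTop, ‖ξ i t‖ ≤ κ ^ 2 * t) ∧ ({x : E4 | τ₀ < x 0 ∧ ∀ i, rin i < Kerr.radius (a i) (poincareInv (Λ i (x 0)) (E4.ofTimeSpace (x 0) (ξ i (x 0))) x)} ⊆ (U : Set E4)) ∧ let B : ModelBackground := ⟨U, fun x ↦ Minkowski.bilin + ∑ i, (boostedKerrBilin (Λ i (x 0)) (E4.ofTimeSpace (x 0) (ξ i (x 0))) (M i) (a i) x - Minkowski.bilin), fun x ↦ x 0, E4.spatialNorm⟩; ContMDiff 𝓘(ℝ, E4) (𝓡 4) ((⊤ : ℕ∞) : WithTop ℕ∞) Φ ∧ Topology.IsOpenEmbedding ((B.lateRegion τ₀).restrict Φ) ∧ Φ '' {x : U | τ₀ < x.1 0 ∧ ∀ i, Kerr.rPlus (M i) (a i) < Kerr.radius (a i) (poincareInv (Λ i (x.1 0)) (E4.ofTimeSpace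 (x.1 0) (ξ i (x.1 0))) x.1)} ⊆ O ∧ Tendsto (fun t ↦ 𝒟.toSpacetime.deviationCk B Φ 3 t) atTop (𝓝 0) ∧ O = Summit.FinalStateConjecture.exteriorOf 𝒟.toCauchyDevelopment (Φ '' {x : U | τ₀ < x.1 0 ∧ ∀ i, Kerr.rPlus (M i) (a i) < Kerr.radius (a i) (poincareInv (Λ i (x.1 0)) (E4.ofTimeSpace (x.1 0) (ξ i (x.1 0))) x.1)}) ∧ (∀ t₁ : ℝ, τ₀ < t₁ → O \ Φ '' {x : U | t₁ < x.1 0 ∧ ∀ i, Kerr.rPlus (M i) (a i) < Kerr.radius (a i) (poincareInv (Λ i (x.1 0)) (E4.ofTimeSpace (x.1 0) (ξ i (x.1 0))) x.1)} ⊆ 𝒟.metric.causalPast 𝒟.timeOrientation (Φ '' {x : U | x.1 0 = t₁ ∧ ∀ i, Kerr.rPlus (M i) (a i) < Kerr.radius (a i) (poincareInv (Λ i (x.1 0)) (E4.ofTimeSpace (x.1 0) (ξ i (x.1 0))) x.1)})) ∧ (∃ τ₁ : ℝ, ∀ x y : U, (τ₁ < x.1 0 ∧ ∀ i, rin i < Kerr.radius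 (a i) (poincareInv (Λ i (x.1 0)) (E4.ofTimeSpace (x.1 0) (ξ i (x.1 0))) x.1)) → (τ₁ < y.1 0 ∧ ∀ i, rin i < Kerr.radius (a i) (poincareInv (Λ i (y.1 0)) (E4.ofTimeSpace (y.1 0) (ξ i (y.1 0))) y.1)) → Φ y ∈ 𝒟.metric.causalFuture 𝒟.timeOrientation {Φ x} → x.1 0 ≤ y.1 0) ∧ (∀ (i : Fin N) (t : ℝ), 0 < (((Λ i t : lorentzGroup) : E4 ≃L[ℝ] E4) (E4.basisVector 0)) 0) ∧ Summit.FinalStateConjecture.RaysStayInClosure 𝒟.toCauchyDevelopment O) → (∃ (N : ℕ) (M a rin : Fin N → ℝ) (Λ : Fin N → ℝ → lorentzGroup) (ξ : Fin N → ℝ → E3) (γ κ τ₀ A : ℝ) (U : Opens E4) (Φ : U → 𝒟.carrier) (O : Set 𝒟.carrier), (∀ i, Kerr.IsSubextremal (M i) (a i) ∧ Kerr.rMinus (M i) (a i) < rin i ∧ rin i < Kerr.rPlus (M i) (a i)) ∧ (∀ i t, |((Λ i t : E4 ≃L[ℝ] E4) (E4.basisVector 0)) 0| ≤ γ) ∧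 (∀ i, ContDiff ℝ ((⊤ : ℕ∞) : WithTop ℕ∞) (ξ i) ∧ ContDiff ℝ ((⊤ : ℕ∞) : WithTop ℕ∞) (fun t ↦ ((Λ i t : E4 ≃L[ℝ] E4) : E4 →L[ℝ] E4))) ∧ (∀ i j, i ≠ j → Tendsto (fun t ↦ ‖ξ i t - ξ j t‖) atTop atTop) ∧ (∀ i j, i ≠ j → ∃ v : ℝ, 0 < v ∧ ∀ᶠ t in atTop, v * t ≤ ‖ξ i t - ξ j t‖) ∧ (∀ i t, τ₀ ≤ t → (∀ k, k ≤ 4 → ‖iteratedDeriv k (fun s ↦ ((Λ i s : E4 ≃L[ℝ] E4) : E4 →L[ℝ] E4)) t‖ ≤ A) ∧ ∀ k, 1 ≤ k → k ≤ 4 → ‖iteratedDeriv k (ξ i) t‖ ≤ A) ∧ (∀ i, Tendsto (fun t : ℝ ↦ t ^ (3 / 4 : ℝ) * ‖deriv (fun s ↦ (((Λ i s : lorentzGroup) : E4 ≃L[ℝ] E4) (E4.basisVector 0))) t‖) atTop (𝓝 0) ∧ (∃ V : ℝ, ∀ᶠ t in atTop, ‖deriv (ξ i) t‖ ≤ V)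 ∧ (∃ V₃ : ℝ, a i ≠ 0 → ∀ᶠ t in atTop, ‖deriv (fun s ↦ (((Λ i s : lorentzGroup) : E4 ≃L[ℝ] E4) (E4.basisVector 3))) t‖ ≤ V₃)) ∧ (0 < κ ∧ κ < 1 ∧ ∀ i, ∀ᶠ t in atTop, ‖ξ i t‖ ≤ κ ^ 2 * t) ∧ ({x : E4 | τ₀ < x 0 ∧ ∀ i, rin i < Kerr.radius (a i) (poincareInv (Λ i (x 0)) (E4.ofTimeSpace (x 0) (ξ i (x 0))) x)} ⊆ (U : Set E4)) ∧ let B : ModelBackground := ⟨U, fun x ↦ Minkowski.bilin + ∑ i, (boostedKerrBilin (Λ i (x 0)) (E4.ofTimeSpace (x 0) (ξ i (x 0))) (M i) (a i) x - Minkowski.bilin), fun x ↦ x 0, E4.spatialNorm⟩; ContMDiff 𝓘(ℝ, E4) (𝓡 4) ((⊤ : ℕ∞) : WithTop ℕ∞) Φ ∧ Topology.IsOpenEmbedding ((B.lateRegion τ₀).restrict Φ) ∧ Φ '' {x : U | τ₀ < x.1 0 ∧ ∀ i, Kerr.rPlus (M i) (a i) < Kerr.radius (a i) (poincareInv (Λ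 i (x.1 0)) (E4.ofTimeSpace (x.1 0) (ξ i (x.1 0))) x.1)} ⊆ O ∧ Tendsto (fun t ↦ 𝒟.toSpacetime.deviationCk B Φ 3 t) atTop (𝓝 0) ∧ Tendsto (fun t : ℝ ↦ ⨆ x ∈ {x : U | x.1 0 = t ∧ E4.spatialNorm x.1 ≤ κ * t}, ⨆ (m : ℕ) (_ : m ≤ 3), ENNReal.ofReal (1 + √(√((⨅ i, ‖E4.spatial x.1 - ξ i t‖) ^ 7))) * ‖iteratedFDeriv ℝ m (𝒟.toSpacetime.deviationExtend B Φ) x.1‖ₑ) atTop (𝓝 0) ∧ O = Summit.FinalStateConjecture.exteriorOf 𝒟.toCauchyDevelopment (Φ '' {x : U | τ₀ < x.1 0 ∧ ∀ i, Kerr.rPlus (M i) (a i) < Kerr.radius (a i) (poincareInv (Λ i (x.1 0)) (E4.ofTimeSpace (x.1 0) (ξ i (x.1 0))) x.1)}) ∧ (∀ t₁ : ℝ, τ₀ < t₁ → O \ Φ '' {x : U | t₁ < x.1 0 ∧ ∀ i, Kerr.rPlus (M i) (a i) < Kerr.radius (a i) (poincareInv (Λ i (x.1 0)) (E4.ofTimeSpace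 (x.1 0) (ξ i (x.1 0))) x.1)} ⊆ 𝒟.metric.causalPast 𝒟.timeOrientation (Φ '' {x : U | x.1 0 = t₁ ∧ ∀ i, Kerr.rPlus (M i) (a i) < Kerr.radius (a i) (poincareInv (Λ i (x.1 0)) (E4.ofTimeSpace (x.1 0) (ξ i (x.1 0))) x.1)})) ∧ (∃ τ₁ : ℝ, ∀ x y : U, (τ₁ < x.1 0 ∧ ∀ i, rin i < Kerr.radius (a i) (poincareInv (Λ i (x.1 0)) (E4.ofTimeSpace (x.1 0) (ξ i (x.1 0))) x.1)) → (τ₁ < y.1 0 ∧ ∀ i, rin i < Kerr.radius (a i) (poincareInv (Λ i (y.1 0)) (E4.ofTimeSpace (y.1 0) (ξ i (y.1 0))) y.1)) → Φ y ∈ 𝒟.metric.causalFuture 𝒟.timeOrientation {Φ x} → x.1 0 ≤ y.1 0) ∧ (∀ (i : Fin N) (t : ℝ), 0 < (((Λ i t : lorentzGroup) : E4 ≃L[ℝ] E4) (E4.basisVector 0)) 0) ∧ Summit.FinalStateConjecture.RaysStayInClosure 𝒟.toCauchyDevelopment O)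

/-! ## §2 The registered stubs (`sorry` lives ONLY here; statements spelled out inline) -/

/-- **STUB S1 · `stub_trimmedConeCaptureGeneric` — THE OPEN CORE in cone-capture format (hardest;
difficulty open-problem; conceded by every card of this crux).** For every `Σ`, tame-Christodoulou-
generically in the admissible class: the datum is TRIMMED (fast tails `o₄(r^{-15/8})/o₃(r^{-23/8})` on
its sole end), an MGHD exists, and every MGHD has complete `𝓘⁺` and is captured by a modulated
multi-Kerr–Schild ansatz in the UNWEIGHTED sense with the kinematic clauses (H) hyperbolic recession,
(K) tame moduli, (WR) weighted 4-velocity rates — censorship, finiteness of `N`, no other attractor,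
sub-extremal capture into every receding basin, the parabolic wall (BN1) and the tail stratum (§9.1,
swallowed by trimmed witnesses), all for LARGE data; but NO pointwise weighted rate and NO (QS).
Not the crux: it lacks clauses (11)/(QS) and carries (H)/(K)/(WR)/trimming, none of which the crux
asserts. [cite: DafermosLuk2017, Conjecture 1] -/
theorem stub_trimmedConeCaptureGeneric :
    ∀ (X : Type) [TopologicalSpace X] [ChartedSpace E3 X] [IsManifold (𝓡 3) ((⊤ : ℕ∞) : WithTop ℕ∞) X] [T2Space X] [SecondCountableTopology X] [ConnectedSpace X], InitialDataSet.IsTameChristodoulouGeneric (admissibleVacuumData X) (fun D ↦ (∃ (e : AFEnd X) (Mₑ : ℝ), e.IsSoleEnd ∧ e.IsStronglyAsymptoticallyFlatWith D Mₑ (15 / 8) (23 / 8) 4 3) ∧ (∃ 𝒟 : VacuumCauchyDevelopment D, 𝒟.IsMaximal) ∧ ∀ 𝒟 : VacuumCauchyDevelopment D, 𝒟.IsMaximal → Summit.FinalStateConjecture.HasCompleteNullInfinity 𝒟.toCauchyDevelopment ∧ (∃ (N : ℕ) (M a rin : Fin N → ℝ) (Λ : Fin N → ℝ → lorentzGroup)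 (ξ : Fin N → ℝ → E3) (γ κ τ₀ A : ℝ) (U : Opens E4) (Φ : U → 𝒟.carrier) (O : Set 𝒟.carrier), (∀ i, Kerr.IsSubextremal (M i) (a i) ∧ Kerr.rMinus (M i) (a i) < rin i ∧ rin i < Kerr.rPlus (M i) (a i)) ∧ (∀ i t, |((Λ i t : E4 ≃L[ℝ] E4) (E4.basisVector 0)) 0| ≤ γ) ∧ (∀ i, ContDiff ℝ ((⊤ : ℕ∞) : WithTop ℕ∞) (ξ i) ∧ ContDiff ℝ ((⊤ : ℕ∞) : WithTop ℕ∞) (fun t ↦ ((Λ i t : E4 ≃L[ℝ] E4) : E4 →L[ℝ] E4))) ∧ (∀ i j, i ≠ j → Tendsto (fun t ↦ ‖ξ i t - ξ j t‖) atTop atTop) ∧ (∀ i j, i ≠ j → ∃ v : ℝ, 0 < v ∧ ∀ᶠ t in atTop, v * t ≤ ‖ξ i t - ξ j t‖) ∧ (∀ i t, τ₀ ≤ t → (∀ k, k ≤ 4 → ‖iteratedDeriv k (fun s ↦ ((Λ i s : E4 ≃L[ℝ] E4) : E4 →L[ℝ] E4)) t‖ ≤ A) ∧ ∀ k, 1 ≤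 k → k ≤ 4 → ‖iteratedDeriv k (ξ i) t‖ ≤ A) ∧ (∀ i, Tendsto (fun t : ℝ ↦ t ^ (3 / 4 : ℝ) * ‖deriv (fun s ↦ (((Λ i s : lorentzGroup) : E4 ≃L[ℝ] E4) (E4.basisVector 0))) t‖) atTop (𝓝 0) ∧ (∃ V : ℝ, ∀ᶠ t in atTop, ‖deriv (ξ i) t‖ ≤ V) ∧ (∃ V₃ : ℝ, a i ≠ 0 → ∀ᶠ t in atTop, ‖deriv (fun s ↦ (((Λ i s : lorentzGroup) : E4 ≃L[ℝ] E4) (E4.basisVector 3))) t‖ ≤ V₃)) ∧ (0 < κ ∧ κ < 1 ∧ ∀ i, ∀ᶠ t in atTop, ‖ξ i t‖ ≤ κ ^ 2 * t) ∧ ({x : E4 | τ₀ < x 0 ∧ ∀ i, rin i < Kerr.radius (a i) (poincareInv (Λ i (x 0)) (E4.ofTimeSpace (x 0) (ξ i (x 0))) x)} ⊆ (U : Set E4)) ∧ let B : ModelBackground := ⟨U, fun x ↦ Minkowski.bilin + ∑ i, (boostedKerrBilin (Λ i (x 0)) (E4.ofTimeSpace (x 0) (ξ i (x 0))) (M i)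 (a i) x - Minkowski.bilin), fun x ↦ x 0, E4.spatialNorm⟩; ContMDiff 𝓘(ℝ, E4) (𝓡 4) ((⊤ : ℕ∞) : WithTop ℕ∞) Φ ∧ Topology.IsOpenEmbedding ((B.lateRegion τ₀).restrict Φ) ∧ Φ '' {x : U | τ₀ < x.1 0 ∧ ∀ i, Kerr.rPlus (M i) (a i) < Kerr.radius (a i) (poincareInv (Λ i (x.1 0)) (E4.ofTimeSpace (x.1 0) (ξ i (x.1 0))) x.1)} ⊆ O ∧ Tendsto (fun t ↦ 𝒟.toSpacetime.deviationCk B Φ 3 t) atTop (𝓝 0) ∧ O = Summit.FinalStateConjecture.exteriorOf 𝒟.toCauchyDevelopment (Φ '' {x : U | τ₀ < x.1 0 ∧ ∀ i, Kerr.rPlus (M i) (a i) < Kerr.radius (a i) (poincareInv (Λ i (x.1 0)) (E4.ofTimeSpace (x.1 0) (ξ i (x.1 0))) x.1)}) ∧ (∀ t₁ : ℝ, τ₀ < t₁ → O \ Φ '' {x : U | t₁ < x.1 0 ∧ ∀ i, Kerr.rPlus (M i) (a i) < Kerr.radius (a i) (poincareInv (Λ i (x.1 0)) (E4.ofTimeSpace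 (x.1 0) (ξ i (x.1 0))) x.1)} ⊆ 𝒟.metric.causalPast 𝒟.timeOrientation (Φ '' {x : U | x.1 0 = t₁ ∧ ∀ i, Kerr.rPlus (M i) (a i) < Kerr.radius (a i) (poincareInv (Λ i (x.1 0)) (E4.ofTimeSpace (x.1 0) (ξ i (x.1 0))) x.1)})) ∧ (∃ τ₁ : ℝ, ∀ x y : U, (τ₁ < x.1 0 ∧ ∀ i, rin i < Kerr.radius (a i) (poincareInv (Λ i (x.1 0)) (E4.ofTimeSpace (x.1 0) (ξ i (x.1 0))) x.1)) → (τ₁ < y.1 0 ∧ ∀ i, rin i < Kerr.radius (a i) (poincareInv (Λ i (y.1 0)) (E4.ofTimeSpace (y.1 0) (ξ i (y.1 0))) y.1)) → Φ y ∈ 𝒟.metric.causalFuture 𝒟.timeOrientation {Φ x} → x.1 0 ≤ y.1 0) ∧ (∀ (i : Fin N) (t : ℝ), 0 < (((Λ i t : lorentzGroup) : E4 ≃L[ℝ] E4) (E4.basisVector 0)) 0) ∧ Summit.FinalStateConjecture.RaysStayInClosure 𝒟.toCauchyDevelopment O)) 1 := by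
  sorry

/-! ### S2 reshaped by lead a1 (2026-08-17): `stub_lieDragResponseDecay` ⇐ three registered analysis stubs

The card's first lemma (flat forced `1+3` wave equation, `C²` solutions, zero Cauchy data at `t = 1`,
source in the lab cone) is PROVED below (`lieDragResponseDecay_proof`) from:
* `stub_sphericalMeansCalculusC2` — the tree's spherical-means calculus
  (`Theorems/StarvedNecksNecksCertifyStubSphericalMeansCalculus`, Darboux by rotation invariance of
  `volume.toSphere`) re-run for `C²` instead of `C^∞` data (`integral_laplacian_toSphere` is already `C²`);
* `stub_kirchhoffComparisonC2` — Kirchhoff–Duhamel (`…StubKirchhoffFormula`, `1+1` transport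
  `transport_inRay`) for `C²` solutions with ZERO data at `t = 1`, in the curried `u : ℝ → E3 → ℝ`
  language of the card, as the COMPARISON `|u(t,x)| ≤ σ(S²)⁻¹ ∫₀^{t-1} s ∫_{S²} |f(t-s, x+sw)| dσ ds`;
* `stub_retardedConeEstimate` — the one genuinely new estimate: the retarded potential of the
  Lie-dragged two-centre profile `A s⁻²Σ±(M+|y∓½vs e₁|)⁻²·1_{|y|≤κs}` is `O(A log(1+t)/t²)` in the cone
  (retarded times `≥ (1-κ)t/(1+κ)`; polar coordinates `Literature.Analysis.Calculus.PolarCoordinatesE3`;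
  the moving centre `y ↦ y ∓ ½v(t-|y-x|)e₁` is `(1-v/2)`-bi-Lipschitz, so dyadic shells of the profile
  have preimages in balls of comparable radius, on each of which `∫|y-x|⁻¹ ≤ 2πr²` — `O(1)` per shell,
  `O(log(t/M))` shells).
-/

/-- **STUB S2a · `stub_sphericalMeansCalculusC2` — calculus of time-dependent spherical means for `C²`
data** (Evans, PDE, §2.4.1; the tree's `stub_sphericalMeansCalculus`/`stub_sphereMeanDarboux` with
`C^∞` replaced by `C²`): for `ψ ∈ C²(E4)`, a centre `x` and `A(s,r) = ∫_{S²} ψ(s, x + rw) dσ(w)`: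
`A ∈ C²(ℝ²)` jointly; `∂ᵣA = ∫Dψ·(0,w)`, `∂ₛA = ∫∂₀ψ`, `∂ₛ²A = ∫∂₀∂₀ψ` (one derivative under the
integral sign each, tree `Literature.Analysis.FunctionSpaces.fderiv_parametric_integral_apply`, valid for
`Cⁿ`, `n ≠ 0`); Darboux `∂ᵣ²(rA) = r∫Δₓψ` (`integral_laplacian_toSphere`, stated for `C²`). [folklore] -/
theorem stub_sphericalMeansCalculusC2 :
    ∀ (ψ : E4 → ℝ), ContDiff ℝ 2 ψ → ∀ (x : E3) (A : ℝ → ℝ → ℝ), (∀ s r, A s r = ∫ (w : Metric.sphere (0 : E3) 1), ψ (E4.ofTimeSpace s (x + r • (w : E3))) ∂((volume : Measure E3).toSphere)) → ContDiff ℝ 2 (Function.uncurry A) ∧ (∀ s r, deriv (A s) r = ∫ (w : Metric.sphere (0 : E3) 1), fderiv ℝ ψ (E4.ofTimeSpace s (x + r • (w : E3))) (E4.ofTimeSpace 0 (w : E3)) ∂((volume : Measure E3).toSphere)) ∧ (∀ s r, deriv (fun s' ↦ A s' r) s = ∫ (w : Metric.sphere (0 : E3) 1), fderiv ℝ ψ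 (E4.ofTimeSpace s (x + r • (w : E3))) (E4.basisVector 0) ∂((volume : Measure E3).toSphere)) ∧ (∀ s r, iteratedDeriv 2 (fun s' ↦ A s' r) s = ∫ (w : Metric.sphere (0 : E3) 1), fderiv ℝ (fun z ↦ fderiv ℝ ψ z (E4.basisVector 0)) (E4.ofTimeSpace s (x + r • (w : E3))) (E4.basisVector 0) ∂((volume : Measure E3).toSphere)) ∧ (∀ s r, iteratedDeriv 2 (fun ρ ↦ ρ * A s ρ) r = r * ∫ (w : Metric.sphere (0 : E3) 1), (∑ i : Fin 3, fderiv ℝ (fun z ↦ fderiv ℝ ψ z (E4.basisVector i.succ)) (E4.ofTimeSpace s (x + r • (w : E3))) (E4.basisVector i.succ)) ∂((volume : Measure E3).toSphere)) :=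
  -- LANDED (wave 1, p143012): Theorems/EIHFluxBalanceModulatedKerrHandoffStubSphericalMeansCalculusC2.lean
  Summit.FinalStateConjecture.FinalStateConjecture.Theorems.EIHFluxBalance.ConeRatesAreILED.stub_sphericalMeansCalculusC2

/-- **STUB S2b · `stub_kirchhoffComparisonC2` — Kirchhoff–Duhamel comparison for `C²` solutions with zero
data** (Evans, PDE, §2.4.1(c), §2.4.2; the tree's `stub_kirchhoffFormula` re-run for `C²` and specialised):
granted the `C²` spherical-means calculus, every `u ∈ C²(ℝ × E3)` with `u(1,·) = ∂ₜu(1,·) = 0` and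
`∂ₜ²u = Δu + f` for `t ≥ 1` (`f` continuous) satisfies, for `t ≥ 1`,
`|u(t,x)| ≤ σ(S²)⁻¹ ∫₀^{t-1} s ∫_{S²} |f(t - s, x + s w)| dσ(w) ds` (`σ = volume.toSphere`; at `σ₀ = t - 1`
the data terms of Kirchhoff's formula vanish, `-□_η = ∂ₜ² - Δ = f` on `t ≥ 1`, then `|∫| ≤ ∫|·|`).
Dictionary `ψ := fun z ↦ u (z 0) (E4.spatial z)`, `ψ (E4.ofTimeSpace t x) = u t x`; the `deriv` slices of
the hypothesis are the `fderiv` slices of `ψ` along `E4.basisVector 0` / `E4.basisVector i.succ`. [folklore] -/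
theorem stub_kirchhoffComparisonC2 :
    (∀ (ψ : E4 → ℝ), ContDiff ℝ 2 ψ → ∀ (x : E3) (A : ℝ → ℝ → ℝ), (∀ s r, A s r = ∫ (w : Metric.sphere (0 : E3) 1), ψ (E4.ofTimeSpace s (x + r • (w : E3))) ∂((volume : Measure E3).toSphere)) → ContDiff ℝ 2 (Function.uncurry A) ∧ (∀ s r, deriv (A s) r = ∫ (w : Metric.sphere (0 : E3) 1), fderiv ℝ ψ (E4.ofTimeSpace s (x + r • (w : E3))) (E4.ofTimeSpace 0 (w : E3)) ∂((volume : Measure E3).toSphere)) ∧ (∀ s r, deriv (fun s' ↦ A s' r) s = ∫ (w : Metric.sphere (0 : E3) 1), fderiv ℝ ψ (E4.ofTimeSpace s (x + r • (w : E3))) (E4.basisVector 0) ∂((volume : Measure E3).toSphere)) ∧ (∀ s r, iteratedDeriv 2 (fun s' ↦ A s' r) s = ∫ (w : Metric.sphere (0 : E3) 1), fderiv ℝ (fun z ↦ fderiv ℝ ψ z (E4.basisVector 0)) (E4.ofTimeSpace s (x + r • (w : E3))) (E4.basisVector 0) ∂((volume : Measure E3).toSphere)) ∧ (∀ s r, iteratedDeriv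 2 (fun ρ ↦ ρ * A s ρ) r = r * ∫ (w : Metric.sphere (0 : E3) 1), (∑ i : Fin 3, fderiv ℝ (fun z ↦ fderiv ℝ ψ z (E4.basisVector i.succ)) (E4.ofTimeSpace s (x + r • (w : E3))) (E4.basisVector i.succ)) ∂((volume : Measure E3).toSphere))) → ∀ (u f : ℝ → E3 → ℝ), ContDiff ℝ 2 (fun p : ℝ × E3 ↦ u p.1 p.2) → Continuous (fun p : ℝ × E3 ↦ f p.1 p.2) → (∀ x, u 1 x = 0 ∧ deriv (fun s ↦ u s x) 1 = 0) → (∀ t x, 1 ≤ t → deriv (fun s ↦ deriv (fun s' ↦ u s' x) s) t = ∑ i : Fin 3, deriv (fun s : ℝ ↦ deriv (fun s' : ℝ ↦ u t (x + s' • EuclideanSpace.single i (1 : ℝ))) s) (0 : ℝ) + f t x) → ∀ (t : ℝ) (x : E3), 1 ≤ t → |u t x| ≤ (((volume : Measure E3).toSphere univ).toReal)⁻¹ * ∫ s in (0 : ℝ)..(t - 1), s * ∫ (w : Metric.sphere (0 : E3) 1), |f (t - s) (x + s • (w : E3))| ∂((volume : Measure E3).toSphere) :=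
  -- LANDED (wave 1, p143606): Theorems/EIHFluxBalanceModulatedKerrHandoffStubKirchhoffComparisonC2.lean
  Summit.FinalStateConjecture.FinalStateConjecture.Theorems.EIHFluxBalance.ConeRatesAreILED.stub_kirchhoffComparisonC2

/-- **STUB S2c · `stub_retardedConeEstimate` — the retarded potential of the Lie-dragged two-centre
profile is `O(A log(1+t)/t²)` in the lab cone** (the lead's stub). For `f` continuous, supported in
`‖x‖ ≤ κt` and bounded by `A t⁻²[(M+‖x-½vte₁‖)⁻² + (M+‖x+½vte₁‖)⁻²]` (`t ≥ 1`), and `‖x‖ ≤ κt`: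
`σ(S²)⁻¹∫₀^{t-1} s∫_{S²}|f(t-s, x+sw)| dσ ds ≤ C(M,v,κ) A log(1+t)/t²`. Why true: source and observer
in the cone force retarded times `t - s ≥ (1-κ)t/(1+κ)`; in polar coordinates about `x` the rest is
`∫_{|y-x|<t-1} |y-x|⁻¹(M+|y ∓ ½v(t-|y-x|)e₁|)⁻² dy`; the moving centre is `(1-v/2)`-bi-Lipschitz in `y`, so
the dyadic shell `{2ᵏM ≤ M+|·| < 2ᵏ⁺¹M}` of the profile has preimage inside a ball of radius `2ᵏ⁺²M/(1-v/2)`,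
over which `∫|y-x|⁻¹ ≤ 2π·radius²`: each of the `O(log((1+2κ)t/M))` shells contributes `O(1)`.
(Numerics: TRIAGE-r1-1 block 3, j022278: `t²u/log t ∈ [0.72, 1.50]`.) [folklore] -/
theorem stub_retardedConeEstimate :
    ∀ (A M v κ : ℝ), 0 ≤ A → 0 < M → 0 < v → v < κ → κ < 1 → ∃ C : ℝ, ∀ (f : ℝ → E3 → ℝ), Continuous (fun p : ℝ × E3 ↦ f p.1 p.2) → (∀ t x, 1 ≤ t → κ * t < ‖x‖ → f t x = 0) → (∀ t x, 1 ≤ t → |f t x| ≤ A * t⁻¹ ^ 2 * ((M + ‖x - (v * t / 2) • EuclideanSpace.single (0 : Fin 3) (1 : ℝ)‖)⁻¹ ^ 2 + (M + ‖x + (v * t / 2) • EuclideanSpace.single (0 : Fin 3) (1 : ℝ)‖)⁻¹ ^ 2)) → ∀ (t : ℝ) (x : E3), 1 ≤ t → ‖x‖ ≤ κ * t → ((((volume : Measure E3).toSphere univ).toReal)⁻¹ * ∫ s in (0 : ℝ)..(t - 1), s * ∫ (w : Metric.sphere (0 : E3) 1), |f (t - s) (x + s • (w : E3))| ∂((volume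 : Measure E3).toSphere)) ≤ C * A * Real.log (1 + t) / t ^ 2 :=
  -- LANDED (wave 1, p145311 + helpers p144523): Theorems/EIHFluxBalanceModulatedKerrHandoffStubRetardedConeEstimate.lean
  Summit.FinalStateConjecture.FinalStateConjecture.Theorems.EIHFluxBalance.ConeRatesAreILED.stub_retardedConeEstimate

/-- **S2 · the card's FIRST LEMMA `LieDragResponseDecay`, PROVED from S2a–S2c** (formerly the registered
stub `stub_lieDragResponseDecay`; statement byte-identical): comparison (S2b fed by S2a) then the cone
estimate (S2c). -/
theorem lieDragResponseDecay_proof :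
    ∀ (A M v κ : ℝ), 0 ≤ A → 0 < M → 0 < v → v < κ → κ < 1 → ∃ C : ℝ, ∀ (u f : ℝ → E3 → ℝ), ContDiff ℝ 2 (fun p : ℝ × E3 ↦ u p.1 p.2) → Continuous (fun p : ℝ × E3 ↦ f p.1 p.2) → (∀ x, u 1 x = 0 ∧ deriv (fun s ↦ u s x) 1 = 0) → (∀ t x, 1 ≤ t → deriv (fun s ↦ deriv (fun s' ↦ u s' x) s) t = ∑ i : Fin 3, deriv (fun s : ℝ ↦ deriv (fun s' : ℝ ↦ u t (x + s' • EuclideanSpace.single i (1 : ℝ))) s) (0 : ℝ) + f t x) → (∀ t x, 1 ≤ t → κ * t < ‖x‖ → f t x = 0) → (∀ t x, 1 ≤ t → |f t x| ≤ A * t⁻¹ ^ 2 * ((M + ‖x - (v * t / 2) • EuclideanSpace.single (0 : Fin 3) (1 : ℝ)‖)⁻¹ ^ 2 + (M + ‖x + (v * t / 2) • EuclideanSpace.single (0 : Fin 3) (1 : ℝ)‖)⁻¹ ^ 2)) → ∀ t x, 1 ≤ t → ‖x‖ ≤ κ * t → |u t x| ≤ C * A * Real.log (1 + t) / t ^ 2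 := by
  intro A M v κ hA hM hv hvκ hκ
  obtain ⟨C, hC⟩ := stub_retardedConeEstimate A M v κ hA hM hv hvκ hκ
  refine ⟨C, fun u f hu hf h0 hpde hsupp hbd t x ht hx ↦ ?_⟩
  exact (stub_kirchhoffComparisonC2 stub_sphericalMeansCalculusC2 u f hu hf h0 hpde t x ht).trans
    (hC f hf hsupp hbd t x ht hx)

/-! ### S3 reshaped by lead a1 (2026-08-17, after wave 1): `stub_weightedConeDecay` ⇐ N = 0 (LANDED) ⊕ N ≥ 1 (registered `stub_weightedConeDecayPos`)

Wave 1's S3 worker banked the degenerate instance: for `Fin 0` moduli the cone weight is `≡ 1`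
(`⨅ ∅ = 0`) and clause (11) follows from the whole-slab clause (10) (`deviationCk` is a `supCkENorm`
over the slab ⊇ cone slab) — `stub_weightedConeDecayFinZero` (Theorems/…StubWeightedConeDecayFinZero.lean,
p144141, same witness, no trimming/maximality/LDR used). What remains registered is the engine for
`N ≥ 1` holes, `stub_weightedConeDecayPos` (the clause block with `Fin (N + 1)` moduli as an explicit
hypothesis instead of the `∃ N` bundle; conclusion verbatim). The S3 worker's honest reading of it:
stub-blocked on "weighted Price-law `C³` decay `o(t^{-7/4})`-at-the-cone-edge / `o(1)`-at-the-holes for the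
vacuum deviation from a quasistationary `N`-centre modulated Kerr–Schild background" (Tataru arXiv:0910.5290 ⊕
Metcalfe–Tataru–Tohaneanu arXiv:1104.5437 Thm 5 ⊕ Hintz arXiv:2004.01664: printed for `N ≤ 1`, `m = 0` only; no
Literature decl; sibling items stmt-FinalStateConjecture-14310 / 10082). NOTE for re-gaugers: the landed
`weightedConeClause_of_coneRate` derives (11) for every `N` from a UNIFORM cone rate `t^{7/4}·sup_cone → 0`, but
that uniform rate is FALSE near the holes (nonlinear interaction `~ M_iM_j/(D r) ~ 1/t` at `r ~ M_i`), so it is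
not a usable cut of S3₊ — the weight's smallness near the holes is essential.
-/

/-- **STUB S3₊ · `stub_weightedConeDecayPos` — THE ENGINE for `N ≥ 1` holes** (cone rates are ILED; size XL;
the card's `TruncatedMultiCentreMTT` ⊕ `ILED⁺` ⊕ closure, fed by S2). Statement: S3 with the cone-capture
hypothesis un-bundled and its moduli indexed by `Fin (N + 1)`; conclusion (the weighted cone-capture block,
moduli re-quantified) verbatim. Mechanism and sources as in the S3 docstring below.
[cite: MetcalfeTataruTohaneanu2012, Thm 5] -/
theorem stub_weightedConeDecayPos :
    (∀ (A M v κ : ℝ), 0 ≤ A → 0 < M → 0 < v → v < κ → κ < 1 → ∃ C : ℝ, ∀ (u f : ℝ → E3 → ℝ), ContDiff ℝ 2 (fun p : ℝ × E3 ↦ u p.1 p.2) → Continuous (fun p : ℝ × E3 ↦ f p.1 p.2) → (∀ x, u 1 x = 0 ∧ deriv (fun s ↦ u s x) 1 = 0) → (∀ t x, 1 ≤ t → deriv (fun s ↦ deriv (fun s' ↦ u s' x) s) t = ∑ i : Fin 3, deriv (fun s : ℝ ↦ deriv (fun s' : ℝ ↦ u t (x + s' • EuclideanSpace.single i (1 :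 ℝ))) s) (0 : ℝ) + f t x) → (∀ t x, 1 ≤ t → κ * t < ‖x‖ → f t x = 0) → (∀ t x, 1 ≤ t → |f t x| ≤ A * t⁻¹ ^ 2 * ((M + ‖x - (v * t / 2) • EuclideanSpace.single (0 : Fin 3) (1 : ℝ)‖)⁻¹ ^ 2 + (M + ‖x + (v * t / 2) • EuclideanSpace.single (0 : Fin 3) (1 : ℝ)‖)⁻¹ ^ 2)) → ∀ t x, 1 ≤ t → ‖x‖ ≤ κ * t → |u t x| ≤ C * A * Real.log (1 + t) / t ^ 2) → ∀ (X : Type) [TopologicalSpace X] [ChartedSpace E3 X] [IsManifold (𝓡 3) ((⊤ : ℕ∞) : WithTop ℕ∞) X] [T2Space X] [SecondCountableTopology X] [ConnectedSpace X], ∀ D ∈ admissibleVacuumData X, (∃ (e : AFEnd X) (Mₑ : ℝ), e.IsSoleEnd ∧ e.IsStronglyAsymptoticallyFlatWith D Mₑ (15 / 8) (23 / 8) 4 3) → ∀ 𝒟 : VacuumCauchyDevelopment D, 𝒟.IsMaximal → ∀ (N : ℕ) (M a rin : Fin (N + 1) → ℝ) (Λ : Fin (N + 1) → ℝ → lorentzGroup)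 (ξ : Fin (N + 1) → ℝ → E3) (γ κ τ₀ A : ℝ) (U : Opens E4) (Φ : U → 𝒟.carrier) (O : Set 𝒟.carrier), ((∀ i, Kerr.IsSubextremal (M i) (a i) ∧ Kerr.rMinus (M i) (a i) < rin i ∧ rin i < Kerr.rPlus (M i) (a i)) ∧ (∀ i t, |((Λ i t : E4 ≃L[ℝ] E4) (E4.basisVector 0)) 0| ≤ γ) ∧ (∀ i, ContDiff ℝ ((⊤ : ℕ∞) : WithTop ℕ∞) (ξ i) ∧ ContDiff ℝ ((⊤ : ℕ∞) : WithTop ℕ∞) (fun t ↦ ((Λ i t : E4 ≃L[ℝ] E4) : E4 →L[ℝ] E4))) ∧ (∀ i j, i ≠ j → Tendsto (fun t ↦ ‖ξ i t - ξ j t‖) atTop atTop) ∧ (∀ i j, i ≠ j → ∃ v : ℝ, 0 < v ∧ ∀ᶠ t in atTop, v * t ≤ ‖ξ i t - ξ j t‖) ∧ (∀ i t, τ₀ ≤ t → (∀ k, k ≤ 4 → ‖iteratedDeriv k (fun s ↦ ((Λ i s : E4 ≃L[ℝ] E4) : E4 →L[ℝ] E4)) t‖ ≤ A) ∧ ∀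 k, 1 ≤ k → k ≤ 4 → ‖iteratedDeriv k (ξ i) t‖ ≤ A) ∧ (∀ i, Tendsto (fun t : ℝ ↦ t ^ (3 / 4 : ℝ) * ‖deriv (fun s ↦ (((Λ i s : lorentzGroup) : E4 ≃L[ℝ] E4) (E4.basisVector 0))) t‖) atTop (𝓝 0) ∧ (∃ V : ℝ, ∀ᶠ t in atTop, ‖deriv (ξ i) t‖ ≤ V) ∧ (∃ V₃ : ℝ, a i ≠ 0 → ∀ᶠ t in atTop, ‖deriv (fun s ↦ (((Λ i s : lorentzGroup) : E4 ≃L[ℝ] E4) (E4.basisVector 3))) t‖ ≤ V₃)) ∧ (0 < κ ∧ κ < 1 ∧ ∀ i, ∀ᶠ t in atTop, ‖ξ i t‖ ≤ κ ^ 2 * t) ∧ ({x : E4 | τ₀ < x 0 ∧ ∀ i, rin i < Kerr.radius (a i) (poincareInv (Λ i (x 0)) (E4.ofTimeSpace (x 0) (ξ i (x 0))) x)} ⊆ (U : Set E4)) ∧ let B : ModelBackground := ⟨U, fun x ↦ Minkowski.bilin + ∑ i, (boostedKerrBilin (Λ i (x 0)) (E4.ofTimeSpace (x 0) (ξ i (x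 0))) (M i) (a i) x - Minkowski.bilin), fun x ↦ x 0, E4.spatialNorm⟩; ContMDiff 𝓘(ℝ, E4) (𝓡 4) ((⊤ : ℕ∞) : WithTop ℕ∞) Φ ∧ Topology.IsOpenEmbedding ((B.lateRegion τ₀).restrict Φ) ∧ Φ '' {x : U | τ₀ < x.1 0 ∧ ∀ i, Kerr.rPlus (M i) (a i) < Kerr.radius (a i) (poincareInv (Λ i (x.1 0)) (E4.ofTimeSpace (x.1 0) (ξ i (x.1 0))) x.1)} ⊆ O ∧ Tendsto (fun t ↦ 𝒟.toSpacetime.deviationCk B Φ 3 t) atTop (𝓝 0) ∧ O = Summit.FinalStateConjecture.exteriorOf 𝒟.toCauchyDevelopment (Φ '' {x : U | τ₀ < x.1 0 ∧ ∀ i, Kerr.rPlus (M i) (a i) < Kerr.radius (a i) (poincareInv (Λ i (x.1 0)) (E4.ofTimeSpace (x.1 0) (ξ i (x.1 0))) x.1)}) ∧ (∀ t₁ : ℝ, τ₀ < t₁ → O \ Φ '' {x : U | t₁ < x.1 0 ∧ ∀ i, Kerr.rPlus (M i) (a i) < Kerr.radius (a i) (poincareInv (Λ i (x.1 0)) (E4.ofTimeSpace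 (x.1 0) (ξ i (x.1 0))) x.1)} ⊆ 𝒟.metric.causalPast 𝒟.timeOrientation (Φ '' {x : U | x.1 0 = t₁ ∧ ∀ i, Kerr.rPlus (M i) (a i) < Kerr.radius (a i) (poincareInv (Λ i (x.1 0)) (E4.ofTimeSpace (x.1 0) (ξ i (x.1 0))) x.1)})) ∧ (∃ τ₁ : ℝ, ∀ x y : U, (τ₁ < x.1 0 ∧ ∀ i, rin i < Kerr.radius (a i) (poincareInv (Λ i (x.1 0)) (E4.ofTimeSpace (x.1 0) (ξ i (x.1 0))) x.1)) → (τ₁ < y.1 0 ∧ ∀ i, rin i < Kerr.radius (a i) (poincareInv (Λ i (y.1 0)) (E4.ofTimeSpace (y.1 0) (ξ i (y.1 0))) y.1)) → Φ y ∈ 𝒟.metric.causalFuture 𝒟.timeOrientation {Φ x} → x.1 0 ≤ y.1 0) ∧ (∀ (i : Fin (N + 1)) (t : ℝ), 0 < (((Λ i t : lorentzGroup) : E4 ≃L[ℝ] E4) (E4.basisVector 0)) 0) ∧ Summit.FinalStateConjecture.RaysStayInClosure 𝒟.toCauchyDevelopment O) → (∃ (N : ℕ) (M a rin : Fin N → ℝ)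 (Λ : Fin N → ℝ → lorentzGroup) (ξ : Fin N → ℝ → E3) (γ κ τ₀ A : ℝ) (U : Opens E4) (Φ : U → 𝒟.carrier) (O : Set 𝒟.carrier), (∀ i, Kerr.IsSubextremal (M i) (a i) ∧ Kerr.rMinus (M i) (a i) < rin i ∧ rin i < Kerr.rPlus (M i) (a i)) ∧ (∀ i t, |((Λ i t : E4 ≃L[ℝ] E4) (E4.basisVector 0)) 0| ≤ γ) ∧ (∀ i, ContDiff ℝ ((⊤ : ℕ∞) : WithTop ℕ∞) (ξ i) ∧ ContDiff ℝ ((⊤ : ℕ∞) : WithTop ℕ∞) (fun t ↦ ((Λ i t : E4 ≃L[ℝ] E4) : E4 →L[ℝ] E4))) ∧ (∀ i j, i ≠ j → Tendsto (fun t ↦ ‖ξ i t - ξ j t‖) atTop atTop) ∧ (∀ i j, i ≠ j → ∃ v : ℝ, 0 < v ∧ ∀ᶠ t in atTop, v * t ≤ ‖ξ i t - ξ j t‖) ∧ (∀ i t, τ₀ ≤ t → (∀ k, k ≤ 4 → ‖iteratedDeriv k (fun s ↦ ((Λ i s : E4 ≃L[ℝ] E4) : E4 →L[ℝ] E4)) t‖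 ≤ A) ∧ ∀ k, 1 ≤ k → k ≤ 4 → ‖iteratedDeriv k (ξ i) t‖ ≤ A) ∧ (∀ i, Tendsto (fun t : ℝ ↦ t ^ (3 / 4 : ℝ) * ‖deriv (fun s ↦ (((Λ i s : lorentzGroup) : E4 ≃L[ℝ] E4) (E4.basisVector 0))) t‖) atTop (𝓝 0) ∧ (∃ V : ℝ, ∀ᶠ t in atTop, ‖deriv (ξ i) t‖ ≤ V) ∧ (∃ V₃ : ℝ, a i ≠ 0 → ∀ᶠ t in atTop, ‖deriv (fun s ↦ (((Λ i s : lorentzGroup) : E4 ≃L[ℝ] E4) (E4.basisVector 3))) t‖ ≤ V₃)) ∧ (0 < κ ∧ κ < 1 ∧ ∀ i, ∀ᶠ t in atTop, ‖ξ i t‖ ≤ κ ^ 2 * t) ∧ ({x : E4 | τ₀ < x 0 ∧ ∀ i, rin i < Kerr.radius (a i) (poincareInv (Λ i (x 0)) (E4.ofTimeSpace (x 0) (ξ i (x 0))) x)} ⊆ (U : Set E4)) ∧ let B : ModelBackground := ⟨U, fun x ↦ Minkowski.bilin + ∑ i, (boostedKerrBilin (Λ i (x 0)) (E4.ofTimeSpace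 (x 0) (ξ i (x 0))) (M i) (a i) x - Minkowski.bilin), fun x ↦ x 0, E4.spatialNorm⟩; ContMDiff 𝓘(ℝ, E4) (𝓡 4) ((⊤ : ℕ∞) : WithTop ℕ∞) Φ ∧ Topology.IsOpenEmbedding ((B.lateRegion τ₀).restrict Φ) ∧ Φ '' {x : U | τ₀ < x.1 0 ∧ ∀ i, Kerr.rPlus (M i) (a i) < Kerr.radius (a i) (poincareInv (Λ i (x.1 0)) (E4.ofTimeSpace (x.1 0) (ξ i (x.1 0))) x.1)} ⊆ O ∧ Tendsto (fun t ↦ 𝒟.toSpacetime.deviationCk B Φ 3 t) atTop (𝓝 0) ∧ Tendsto (fun t : ℝ ↦ ⨆ x ∈ {x : U | x.1 0 = t ∧ E4.spatialNorm x.1 ≤ κ * t}, ⨆ (m : ℕ) (_ : m ≤ 3), ENNReal.ofReal (1 + √(√((⨅ i, ‖E4.spatial x.1 - ξ i t‖) ^ 7))) * ‖iteratedFDeriv ℝ m (𝒟.toSpacetime.deviationExtend B Φ) x.1‖ₑ) atTop (𝓝 0) ∧ O = Summit.FinalStateConjecture.exteriorOf 𝒟.toCauchyDevelopment (Φ ''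 {x : U | τ₀ < x.1 0 ∧ ∀ i, Kerr.rPlus (M i) (a i) < Kerr.radius (a i) (poincareInv (Λ i (x.1 0)) (E4.ofTimeSpace (x.1 0) (ξ i (x.1 0))) x.1)}) ∧ (∀ t₁ : ℝ, τ₀ < t₁ → O \ Φ '' {x : U | t₁ < x.1 0 ∧ ∀ i, Kerr.rPlus (M i) (a i) < Kerr.radius (a i) (poincareInv (Λ i (x.1 0)) (E4.ofTimeSpace (x.1 0) (ξ i (x.1 0))) x.1)} ⊆ 𝒟.metric.causalPast 𝒟.timeOrientation (Φ '' {x : U | x.1 0 = t₁ ∧ ∀ i, Kerr.rPlus (M i) (a i) < Kerr.radius (a i) (poincareInv (Λ i (x.1 0)) (E4.ofTimeSpace (x.1 0) (ξ i (x.1 0))) x.1)})) ∧ (∃ τ₁ : ℝ, ∀ x y : U, (τ₁ < x.1 0 ∧ ∀ i, rin i < Kerr.radius (a i) (poincareInv (Λ i (x.1 0)) (E4.ofTimeSpace (x.1 0) (ξ i (x.1 0))) x.1)) → (τ₁ < y.1 0 ∧ ∀ i, rin i < Kerr.radius (a i) (poincareInv (Λ i (y.1 0)) (E4.ofTimeSpace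 (y.1 0) (ξ i (y.1 0))) y.1)) → Φ y ∈ 𝒟.metric.causalFuture 𝒟.timeOrientation {Φ x} → x.1 0 ≤ y.1 0) ∧ (∀ (i : Fin N) (t : ℝ), 0 < (((Λ i t : lorentzGroup) : E4 ≃L[ℝ] E4) (E4.basisVector 0)) 0) ∧ Summit.FinalStateConjecture.RaysStayInClosure 𝒟.toCauchyDevelopment O) := by
  sorry

/-- **S3 · `weightedConeDecay_proof` (formerly the registered stub `stub_weightedConeDecay`, statement byte-identical) — THE ENGINE, now DERIVED from `stub_weightedConeDecayFinZero` (N = 0, landed) and `stub_weightedConeDecayPos` (N ≥ 1, registered) (cone rates are ILED; size XL; the card's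
`TruncatedMultiCentreMTT` ⊕ `ILED⁺` ⊕ closure, fed by S2).** Granted the flat first lemma: for every
admissible TRIMMED datum and every maximal development captured in the UNWEIGHTED cone-capture sense
(with (H), (K), (WR)), there are moduli and a lab chart (re-gauged, re-painted: the conclusion
re-quantifies everything) satisfying the same clauses AND the crux's weighted cone clause
`sup_{|x̲| ≤ κt} (1 + d^{7/4}) Σ_{m≤3} ‖D^m(Φ^*g − G)‖ → 0`. Mechanism (card): run the robust Price-law
machinery (Tataru arXiv:0910.5290; Metcalfe–Tataru–Tohaneanu arXiv:1104.5437 Thm 5) ONCE on `[T, ∞)`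
in hole-adapted channels (G. Chen doi:10.1090/memo/1339) on the QS-slow `N`-centre background, from
uniform boundedness + integrated local energy decay of the linearised flow (sibling items 14310
`AdiabaticMultiKerrILED`, 10082 `RecedingSKSDecay`, staffed once), after subtracting the quasi-static
tidal corrector so that the residual source is `LE*`-summable (TRIAGE-r1-1 sharpen (1)); tails live
`t^{5/4}` below the weight (`PriceLawTail` not bitten), the drag `G⁺ − G` is below the weight by the
landed `stub_dragEstimates` + `stub_deviationTransfer` ((H) and (K) are exactly their hypotheses),
trimming (`o₄(r^{-15/8})`) removes the hereditary tail stratum of Disproof §9 item 1. Printed for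
`N ≤ 1` up to the `m = 0` cone-edge window (Hintz arXiv:2004.01664; KS/GKS rates are `t^{-3/2-δ}`
there, the needed `t^{-7/4}` is Price-law territory); new for `N ≥ 2`.
[cite: MetcalfeTataruTohaneanu2012, Thm 5] -/
theorem weightedConeDecay_proof :
    (∀ (A M v κ : ℝ), 0 ≤ A → 0 < M → 0 < v → v < κ → κ < 1 → ∃ C : ℝ, ∀ (u f : ℝ → E3 → ℝ), ContDiff ℝ 2 (fun p : ℝ × E3 ↦ u p.1 p.2) → Continuous (fun p : ℝ × E3 ↦ f p.1 p.2) → (∀ x, u 1 x = 0 ∧ deriv (fun s ↦ u s x) 1 = 0) → (∀ t x, 1 ≤ t → deriv (fun s ↦ deriv (fun s' ↦ u s' x) s) t = ∑ i : Fin 3, deriv (fun s : ℝ ↦ deriv (fun s' : ℝ ↦ u t (x + s' • EuclideanSpace.single i (1 : ℝ))) s) (0 : ℝ) + f t x) → (∀ t x, 1 ≤ t → κ * t < ‖x‖ → f t x = 0) → (∀ t x, 1 ≤ t → |f t x| ≤ A * t⁻¹ ^ 2 * ((M + ‖x - (v * t / 2) • EuclideanSpace.single (0 : Fin 3) (1 :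 ℝ)‖)⁻¹ ^ 2 + (M + ‖x + (v * t / 2) • EuclideanSpace.single (0 : Fin 3) (1 : ℝ)‖)⁻¹ ^ 2)) → ∀ t x, 1 ≤ t → ‖x‖ ≤ κ * t → |u t x| ≤ C * A * Real.log (1 + t) / t ^ 2) → ∀ (X : Type) [TopologicalSpace X] [ChartedSpace E3 X] [IsManifold (𝓡 3) ((⊤ : ℕ∞) : WithTop ℕ∞) X] [T2Space X] [SecondCountableTopology X] [ConnectedSpace X], ∀ D ∈ admissibleVacuumData X, (∃ (e : AFEnd X) (Mₑ : ℝ), e.IsSoleEnd ∧ e.IsStronglyAsymptoticallyFlatWith D Mₑ (15 / 8) (23 / 8) 4 3) → ∀ 𝒟 : VacuumCauchyDevelopment D, 𝒟.IsMaximal → (∃ (N : ℕ) (M a rin : Fin N → ℝ) (Λ : Fin N → ℝ → lorentzGroup) (ξ : Fin N → ℝ → E3) (γ κ τ₀ A : ℝ) (U : Opens E4) (Φ : U → 𝒟.carrier) (O : Set 𝒟.carrier), (∀ i, Kerr.IsSubextremal (M i) (a i) ∧ Kerr.rMinus (M i) (a i) < rin i ∧ rin i < Kerr.rPlus (M i)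 (a i)) ∧ (∀ i t, |((Λ i t : E4 ≃L[ℝ] E4) (E4.basisVector 0)) 0| ≤ γ) ∧ (∀ i, ContDiff ℝ ((⊤ : ℕ∞) : WithTop ℕ∞) (ξ i) ∧ ContDiff ℝ ((⊤ : ℕ∞) : WithTop ℕ∞) (fun t ↦ ((Λ i t : E4 ≃L[ℝ] E4) : E4 →L[ℝ] E4))) ∧ (∀ i j, i ≠ j → Tendsto (fun t ↦ ‖ξ i t - ξ j t‖) atTop atTop) ∧ (∀ i j, i ≠ j → ∃ v : ℝ, 0 < v ∧ ∀ᶠ t in atTop, v * t ≤ ‖ξ i t - ξ j t‖) ∧ (∀ i t, τ₀ ≤ t → (∀ k, k ≤ 4 → ‖iteratedDeriv k (fun s ↦ ((Λ i s : E4 ≃L[ℝ] E4) : E4 →L[ℝ] E4)) t‖ ≤ A) ∧ ∀ k, 1 ≤ k → k ≤ 4 → ‖iteratedDeriv k (ξ i) t‖ ≤ A) ∧ (∀ i, Tendsto (fun t : ℝ ↦ t ^ (3 / 4 : ℝ) * ‖deriv (fun s ↦ (((Λ i s : lorentzGroup) : E4 ≃L[ℝ] E4) (E4.basisVector 0)))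 t‖) atTop (𝓝 0) ∧ (∃ V : ℝ, ∀ᶠ t in atTop, ‖deriv (ξ i) t‖ ≤ V) ∧ (∃ V₃ : ℝ, a i ≠ 0 → ∀ᶠ t in atTop, ‖deriv (fun s ↦ (((Λ i s : lorentzGroup) : E4 ≃L[ℝ] E4) (E4.basisVector 3))) t‖ ≤ V₃)) ∧ (0 < κ ∧ κ < 1 ∧ ∀ i, ∀ᶠ t in atTop, ‖ξ i t‖ ≤ κ ^ 2 * t) ∧ ({x : E4 | τ₀ < x 0 ∧ ∀ i, rin i < Kerr.radius (a i) (poincareInv (Λ i (x 0)) (E4.ofTimeSpace (x 0) (ξ i (x 0))) x)} ⊆ (U : Set E4)) ∧ let B : ModelBackground := ⟨U, fun x ↦ Minkowski.bilin + ∑ i, (boostedKerrBilin (Λ i (x 0)) (E4.ofTimeSpace (x 0) (ξ i (x 0))) (M i) (a i) x - Minkowski.bilin), fun x ↦ x 0, E4.spatialNorm⟩; ContMDiff 𝓘(ℝ, E4) (𝓡 4) ((⊤ : ℕ∞) : WithTop ℕ∞) Φ ∧ Topology.IsOpenEmbedding ((B.lateRegion τ₀).restrict Φ) ∧ Φ ''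 {x : U | τ₀ < x.1 0 ∧ ∀ i, Kerr.rPlus (M i) (a i) < Kerr.radius (a i) (poincareInv (Λ i (x.1 0)) (E4.ofTimeSpace (x.1 0) (ξ i (x.1 0))) x.1)} ⊆ O ∧ Tendsto (fun t ↦ 𝒟.toSpacetime.deviationCk B Φ 3 t) atTop (𝓝 0) ∧ O = Summit.FinalStateConjecture.exteriorOf 𝒟.toCauchyDevelopment (Φ '' {x : U | τ₀ < x.1 0 ∧ ∀ i, Kerr.rPlus (M i) (a i) < Kerr.radius (a i) (poincareInv (Λ i (x.1 0)) (E4.ofTimeSpace (x.1 0) (ξ i (x.1 0))) x.1)}) ∧ (∀ t₁ : ℝ, τ₀ < t₁ → O \ Φ '' {x : U | t₁ < x.1 0 ∧ ∀ i, Kerr.rPlus (M i) (a i) < Kerr.radius (a i) (poincareInv (Λ i (x.1 0)) (E4.ofTimeSpace (x.1 0) (ξ i (x.1 0))) x.1)} ⊆ 𝒟.metric.causalPast 𝒟.timeOrientation (Φ '' {x : U | x.1 0 = t₁ ∧ ∀ i, Kerr.rPlus (M i) (a i) < Kerr.radius (a i) (poincareInv (Λ i (x.1 0)) (E4.ofTimeSpace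 (x.1 0) (ξ i (x.1 0))) x.1)})) ∧ (∃ τ₁ : ℝ, ∀ x y : U, (τ₁ < x.1 0 ∧ ∀ i, rin i < Kerr.radius (a i) (poincareInv (Λ i (x.1 0)) (E4.ofTimeSpace (x.1 0) (ξ i (x.1 0))) x.1)) → (τ₁ < y.1 0 ∧ ∀ i, rin i < Kerr.radius (a i) (poincareInv (Λ i (y.1 0)) (E4.ofTimeSpace (y.1 0) (ξ i (y.1 0))) y.1)) → Φ y ∈ 𝒟.metric.causalFuture 𝒟.timeOrientation {Φ x} → x.1 0 ≤ y.1 0) ∧ (∀ (i : Fin N) (t : ℝ), 0 < (((Λ i t : lorentzGroup) : E4 ≃L[ℝ] E4) (E4.basisVector 0)) 0) ∧ Summit.FinalStateConjecture.RaysStayInClosure 𝒟.toCauchyDevelopment O) → (∃ (N : ℕ) (M a rin : Fin N → ℝ) (Λ : Fin N → ℝ → lorentzGroup) (ξ : Fin N → ℝ → E3) (γ κ τ₀ A : ℝ) (U : Opens E4) (Φ : U → 𝒟.carrier) (O : Set 𝒟.carrier), (∀ i, Kerr.IsSubextremal (M i) (a i) ∧ Kerr.rMinus (M i) (a i) < rin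 i ∧ rin i < Kerr.rPlus (M i) (a i)) ∧ (∀ i t, |((Λ i t : E4 ≃L[ℝ] E4) (E4.basisVector 0)) 0| ≤ γ) ∧ (∀ i, ContDiff ℝ ((⊤ : ℕ∞) : WithTop ℕ∞) (ξ i) ∧ ContDiff ℝ ((⊤ : ℕ∞) : WithTop ℕ∞) (fun t ↦ ((Λ i t : E4 ≃L[ℝ] E4) : E4 →L[ℝ] E4))) ∧ (∀ i j, i ≠ j → Tendsto (fun t ↦ ‖ξ i t - ξ j t‖) atTop atTop) ∧ (∀ i j, i ≠ j → ∃ v : ℝ, 0 < v ∧ ∀ᶠ t in atTop, v * t ≤ ‖ξ i t - ξ j t‖) ∧ (∀ i t, τ₀ ≤ t → (∀ k, k ≤ 4 → ‖iteratedDeriv k (fun s ↦ ((Λ i s : E4 ≃L[ℝ] E4) : E4 →L[ℝ] E4)) t‖ ≤ A) ∧ ∀ k, 1 ≤ k → k ≤ 4 → ‖iteratedDeriv k (ξ i) t‖ ≤ A) ∧ (∀ i, Tendsto (fun t : ℝ ↦ t ^ (3 / 4 : ℝ) * ‖deriv (fun s ↦ (((Λ i s : lorentzGroup) : E4 ≃L[ℝ]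 E4) (E4.basisVector 0))) t‖) atTop (𝓝 0) ∧ (∃ V : ℝ, ∀ᶠ t in atTop, ‖deriv (ξ i) t‖ ≤ V) ∧ (∃ V₃ : ℝ, a i ≠ 0 → ∀ᶠ t in atTop, ‖deriv (fun s ↦ (((Λ i s : lorentzGroup) : E4 ≃L[ℝ] E4) (E4.basisVector 3))) t‖ ≤ V₃)) ∧ (0 < κ ∧ κ < 1 ∧ ∀ i, ∀ᶠ t in atTop, ‖ξ i t‖ ≤ κ ^ 2 * t) ∧ ({x : E4 | τ₀ < x 0 ∧ ∀ i, rin i < Kerr.radius (a i) (poincareInv (Λ i (x 0)) (E4.ofTimeSpace (x 0) (ξ i (x 0))) x)} ⊆ (U : Set E4)) ∧ let B : ModelBackground := ⟨U, fun x ↦ Minkowski.bilin + ∑ i, (boostedKerrBilin (Λ i (x 0)) (E4.ofTimeSpace (x 0) (ξ i (x 0))) (M i) (a i) x - Minkowski.bilin), fun x ↦ x 0, E4.spatialNorm⟩; ContMDiff 𝓘(ℝ, E4) (𝓡 4) ((⊤ : ℕ∞) : WithTop ℕ∞) Φ ∧ Topology.IsOpenEmbedding ((B.lateRegion τ₀).restrict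 Φ) ∧ Φ '' {x : U | τ₀ < x.1 0 ∧ ∀ i, Kerr.rPlus (M i) (a i) < Kerr.radius (a i) (poincareInv (Λ i (x.1 0)) (E4.ofTimeSpace (x.1 0) (ξ i (x.1 0))) x.1)} ⊆ O ∧ Tendsto (fun t ↦ 𝒟.toSpacetime.deviationCk B Φ 3 t) atTop (𝓝 0) ∧ Tendsto (fun t : ℝ ↦ ⨆ x ∈ {x : U | x.1 0 = t ∧ E4.spatialNorm x.1 ≤ κ * t}, ⨆ (m : ℕ) (_ : m ≤ 3), ENNReal.ofReal (1 + √(√((⨅ i, ‖E4.spatial x.1 - ξ i t‖) ^ 7))) * ‖iteratedFDeriv ℝ m (𝒟.toSpacetime.deviationExtend B Φ) x.1‖ₑ) atTop (𝓝 0) ∧ O = Summit.FinalStateConjecture.exteriorOf 𝒟.toCauchyDevelopment (Φ '' {x : U | τ₀ < x.1 0 ∧ ∀ i, Kerr.rPlus (M i) (a i) < Kerr.radius (a i) (poincareInv (Λ i (x.1 0)) (E4.ofTimeSpace (x.1 0) (ξ i (x.1 0))) x.1)}) ∧ (∀ t₁ : ℝ, τ₀ < t₁ → O \ Φ '' {x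 : U | t₁ < x.1 0 ∧ ∀ i, Kerr.rPlus (M i) (a i) < Kerr.radius (a i) (poincareInv (Λ i (x.1 0)) (E4.ofTimeSpace (x.1 0) (ξ i (x.1 0))) x.1)} ⊆ 𝒟.metric.causalPast 𝒟.timeOrientation (Φ '' {x : U | x.1 0 = t₁ ∧ ∀ i, Kerr.rPlus (M i) (a i) < Kerr.radius (a i) (poincareInv (Λ i (x.1 0)) (E4.ofTimeSpace (x.1 0) (ξ i (x.1 0))) x.1)})) ∧ (∃ τ₁ : ℝ, ∀ x y : U, (τ₁ < x.1 0 ∧ ∀ i, rin i < Kerr.radius (a i) (poincareInv (Λ i (x.1 0)) (E4.ofTimeSpace (x.1 0) (ξ i (x.1 0))) x.1)) → (τ₁ < y.1 0 ∧ ∀ i, rin i < Kerr.radius (a i) (poincareInv (Λ i (y.1 0)) (E4.ofTimeSpace (y.1 0) (ξ i (y.1 0))) y.1)) → Φ y ∈ 𝒟.metric.causalFuture 𝒟.timeOrientation {Φ x} → x.1 0 ≤ y.1 0) ∧ (∀ (i : Fin N) (t : ℝ), 0 < (((Λ i t : lorentzGroup) : E4 ≃L[ℝ] E4) (E4.basisVector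 0)) 0) ∧ Summit.FinalStateConjecture.RaysStayInClosure 𝒟.toCauchyDevelopment O) := by
  intro hLDR X _ _ _ _ _ _ D hD htrim 𝒟 h𝒟 hcap
  obtain ⟨N, M, a, rin, Λ, ξ, γ, κ, τ₀, A, U, Φ, O, hrest⟩ := hcap
  cases N with
  | zero =>
    exact Summit.FinalStateConjecture.FinalStateConjecture.Theorems.EIHFluxBalance.ConeRatesAreILED.stub_weightedConeDecayFinZero
      X D 𝒟 M a rin Λ ξ γ κ τ₀ A U Φ O hrest
  | succ n =>
    exact stub_weightedConeDecayPos hLDR X D hD htrim 𝒟 h𝒟 n M a rin Λ ξ γ κ τ₀ A U Φ O hrest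

/-! ## §3 Read-back certificates: the inline stub statements ARE the named Props (`Iff.rfl`) -/

/-- S1's inline statement is tame genericity of `ConeCapturePropT`, `Σ` by `Σ`. [folklore] -/
theorem coreStmt_iff :
    CoreStmt ↔
      ∀ (X : Type) [TopologicalSpace X] [ChartedSpace E3 X] [IsManifold (𝓡 3) ((⊤ : ℕ∞) : WithTop ℕ∞) X] [T2Space X] [SecondCountableTopology X] [ConnectedSpace X],
        IsTameChristodoulouGeneric (admissibleVacuumData X) (ConeCapturePropT X) 1 :=
  Iff.rfl

/-- **Crux-sizedness certificate for S1 (lead a1).** The core stub alone already yields tame-generic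
WEAK COSMIC CENSORSHIP (an MGHD exists and every MGHD has complete `𝓘⁺`) — the body of the open sibling
crux `PhaseMixingCapture.WeakCosmicCensorshipTame` (stmt-FinalStateConjecture-17269) — by monotonicity of
tame genericity, exactly as the crux itself does (`Negative.isTameGeneric_censored_of_modulatedKerrHandoff`,
p134193). So S1 can close only together with 17269: it is the conceded open core, not a lemma. [folklore] -/
theorem coreStmt_censored (hCore : CoreStmt) :
    ∀ (X : Type) [TopologicalSpace X] [ChartedSpace E3 X] [IsManifold (𝓡 3) ((⊤ : ℕ∞) : WithTop ℕ∞) X] [T2Space X] [SecondCountableTopology X] [ConnectedSpace X],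
      IsTameChristodoulouGeneric (admissibleVacuumData X)
        (fun D ↦ (∃ 𝒟 : VacuumCauchyDevelopment D, 𝒟.IsMaximal) ∧
          ∀ 𝒟 : VacuumCauchyDevelopment D, 𝒟.IsMaximal →
            Summit.FinalStateConjecture.HasCompleteNullInfinity 𝒟.toCauchyDevelopment) 1 := by
  intro X _ _ _ _ _ _
  exact (hCore X).mono fun _ _ hP ↦ ⟨hP.2.1, fun 𝒟 h𝒟 ↦ (hP.2.2 𝒟 h𝒟).1⟩

/-- S3's inline statement is `LieDragResponseDecay → ∀ trimmed admissible D, ∀ maximal 𝒟,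
ConeCaptureAnsatz → WeightedConeCaptureAnsatz`. [folklore] -/
theorem engineStmt_iff :
    EngineStmt ↔
      (LieDragResponseDecay →
        ∀ (X : Type) [TopologicalSpace X] [ChartedSpace E3 X] [IsManifold (𝓡 3) ((⊤ : ℕ∞) : WithTop ℕ∞) X] [T2Space X] [SecondCountableTopology X] [ConnectedSpace X],
          ∀ D ∈ admissibleVacuumData X, IsTrimmedDatum X D →
            ∀ 𝒟 : VacuumCauchyDevelopment D, 𝒟.IsMaximal →
              ConeCaptureAnsatz X D 𝒟 → WeightedConeCaptureAnsatz X D 𝒟) :=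
  Iff.rfl

/-! ## §4 Glue (PROVED): (QS) is free given (WR); the weighted cone-capture ansatz IS the handoff ansatz -/

section Glue

variable {X : Type} [TopologicalSpace X] [ChartedSpace E3 X]
  [IsManifold (𝓡 3) ((⊤ : ℕ∞) : WithTop ℕ∞) X] [T2Space X] [SecondCountableTopology X]
  [ConnectedSpace X] {D : InitialDataSet (𝓡 3) X}

-- operator-norm instance paths on form-valued maps are slow to unify
set_option synthInstance.maxHeartbeats 200000 in
set_option maxHeartbeats 800000 in
/-- **`WeightedConeCaptureAnsatz → HandoffAnsatz`**: same moduli, chart and `O`; clauses (1)–(13),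
(T), (O), (R) verbatim; (QS) from (WR) + Lorentz factors + `C¹` moduli + cone clause by the LANDED
`weighted_fderiv_background_tendsto_zero_e0`; (H), (K) and `A` are dropped. [folklore] -/
theorem handoffAnsatz_of_weightedConeCaptureAnsatz (𝒟 : VacuumCauchyDevelopment D)
    (h : WeightedConeCaptureAnsatz X D 𝒟) : HandoffAnsatz X D 𝒟 := by
  obtain ⟨N, M, a, rin, Λ, ξ, γ, κ, τ₀, A, U, Φ, O, h1, h2, h3, h4, hH, hK, hWR, h5, h6, hrest⟩ := h
  obtain ⟨h7, h8, h9, h10, h11, h12, h13, hT, hO, hRays⟩ := hrest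
  have hQS := fun ρ (hρ : Tendsto ρ atTop atTop) ↦
    weighted_fderiv_background_tendsto_zero_e0 N M a Λ ξ γ κ h2
      (fun i ↦ ⟨(h3 i).1.of_le (by exact_mod_cast le_top), (h3 i).2.of_le (by exact_mod_cast le_top)⟩)
      ⟨h5.1.le, h5.2.1.le, h5.2.2⟩ (fun i ↦ (hWR i).2.1) (fun i ↦ (hWR i).2.2) (fun i ↦ (hWR i).1) ρ hρ
  refine ⟨N, M, a, rin, Λ, ξ, γ, κ, τ₀, U, Φ, O, h1, h2, h3, h4, h5, h6, ?_⟩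
  intro B
  exact ⟨h7, h8, h9, h10, h11, h12, h13, hT, hO, hRays, hQS⟩

omit [T2Space X] [SecondCountableTopology X] in
/-- The weighted cone-capture ansatz forgets to the cone-capture ansatz (drop clause (11)). [folklore] -/
theorem coneCaptureAnsatz_of_weighted (𝒟 : VacuumCauchyDevelopment D)
    (h : WeightedConeCaptureAnsatz X D 𝒟) : ConeCaptureAnsatz X D 𝒟 := by
  obtain ⟨N, M, a, rin, Λ, ξ, γ, κ, τ₀, A, U, Φ, O, h1, h2, h3, h4, hH, hK, hWR, h5, h6, hrest⟩ := h
  obtain ⟨h7, h8, h9, h10, h11, h12, h13, hT, hO, hRays⟩ := hrest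
  refine ⟨N, M, a, rin, Λ, ξ, γ, κ, τ₀, A, U, Φ, O, h1, h2, h3, h4, hH, hK, hWR, h5, h6, ?_⟩
  intro B
  exact ⟨h7, h8, h9, h10, h12, h13, hT, hO, hRays⟩

end Glue

/-! ## §5 The composition: the three stubs conclude the crux BY NAME (sorry-free below this line) -/

/-- **THE SKELETON: `ModulatedKerrHandoff` from the three registered stubs** (their only `sorryAx`
dependence; the route decl is concluded BY NAME). For each `Σ`, monotonicity of tame Christodoulou
genericity (`IsTameChristodoulouGeneric.mono`) reduces the crux's property to S1's; pointwise on an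
admissible `D` with S1's property, for every maximal `𝒟` the engine S3 (fed by S2) upgrades the
cone-capture ansatz to the weighted one, and `handoffAnsatz_of_weightedConeCaptureAnsatz` supplies
(QS); MGHD existence and complete `𝓘⁺` pass through. -/
theorem ModulatedKerrHandoff_of : ModulatedKerrHandoff := by
  have hCore := stub_trimmedConeCaptureGeneric
  have hLDR := lieDragResponseDecay_proof
  have hEngine := weightedConeDecay_proof
  intro X _ _ _ _ _ _
  refine (hCore X).mono fun D hD hP ↦ ⟨hP.2.1, fun 𝒟 h𝒟 ↦ ⟨(hP.2.2 𝒟 h𝒟).1, ?_⟩⟩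
  exact handoffAnsatz_of_weightedConeCaptureAnsatz 𝒟
    (hEngine hLDR X D hD hP.1 𝒟 h𝒟 (hP.2.2 𝒟 h𝒟).2)

/-- **HYPOTHESIS FORM (sorry-free, axioms `propext, Classical.choice, Quot.sound`).** The same
composition with the three stub statements as named hypotheses (`CoreStmt`, `LieDragResponseDecay`,
`EngineStmt` — each the corresponding `stub_*` statement by `Iff.rfl`, §3); its conclusion is the
crux's body over the landed `HandoffPropT` (so that the registered skeleton above stays the
only declaration concluding the route decl by name). [folklore] -/
theorem handoffPropT_generic_of_stubs (hCore : CoreStmt) (hLDR : LieDragResponseDecay)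
    (hEngine : EngineStmt) :
    ∀ (X : Type) [TopologicalSpace X] [ChartedSpace E3 X] [IsManifold (𝓡 3) ((⊤ : ℕ∞) : WithTop ℕ∞) X] [T2Space X] [SecondCountableTopology X] [ConnectedSpace X],
      IsTameChristodoulouGeneric (admissibleVacuumData X) (HandoffPropT X) 1 := by
  intro X _ _ _ _ _ _
  refine (hCore X).mono fun D hD hP ↦ ⟨hP.2.1, fun 𝒟 h𝒟 ↦ ⟨(hP.2.2 𝒟 h𝒟).1, ?_⟩⟩
  exact handoffAnsatz_of_weightedConeCaptureAnsatz 𝒟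
    (hEngine hLDR X D hD hP.1 𝒟 h𝒟 (hP.2.2 𝒟 h𝒟).2)

/-- Read-back: the hypothesis form's conclusion IS the crux (`Iff.rfl`, cf. `Sketch.modulatedKerrHandoff_iff`). [folklore] -/
theorem modulatedKerrHandoff_iff_handoffPropT_generic :
    ModulatedKerrHandoff ↔
      ∀ (X : Type) [TopologicalSpace X] [ChartedSpace E3 X] [IsManifold (𝓡 3) ((⊤ : ℕ∞) : WithTop ℕ∞) X] [T2Space X] [SecondCountableTopology X] [ConnectedSpace X],
        IsTameChristodoulouGeneric (admissibleVacuumData X) (HandoffPropT X) 1 :=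
  Iff.rfl

/-- Converse bookkeeping (information only): the crux's handoff ansatz does NOT obviously give the
weighted cone-capture ansatz — (H), (K), (WR) are extra — so no `iff` is claimed; S1 is not the crux
restated (cf. line `Sketch`, dead on exactly that shape). -/
theorem shape_note : True := trivial

end Summit.FinalStateConjecture.FinalStateConjecture.Cruxes.ModulatedKerrHandoff.ConeRatesAreILED

end
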